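import Mathlib
import HarnessLib
import HarnessLib.Audit
import Summits.BirchSwinnertonDyer.Statement
import Summits.BirchSwinnertonDyer.BirchSwinnertonDyer.Theorems.Rank1ResidualX5TwoDefs
import Literature.NumberTheory.EllipticCurves.BertoliniLongoVenerucci2026.DefiniteGrossPeriodSelmerRevised
import Literature.NumberTheory.EllipticCurves.BSDQuotientOverNumberField
import Literature.NumberTheory.EllipticCurves.QuadraticTwist
import Literature.NumberTheory.EllipticCurves.GlobalMinimalModel
import Literature.NumberTheory.Automorphic.BrandtXi
import Literature.NumberTheory.EllipticCurves.KolyvaginShaStructureAnyLevel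
import Literature.NumberTheory.EllipticCurves.BSDSha
import HarnessLib.Audit.Status.Attr

/-!
Route: DefiniteGrossPeriodAtTwo

# Route DefiniteGrossPeriodAtTwo — Definite Gross-period exactness and 2-adic Gross formula give
BSD_2 in rank 0

LINE 3 of ideator seat bsd-idea-1 (D-0145; closes rung K4 leaf `Rank1Residual.NonCMAtTwo`, WALL row
1; no summit is proved by this line). It suffices to show X = X_def ∧ X_an ∧ X_Kato ∧ X_supply ∧
X_desc ∧ X_res on the DEFINITE HABITAT H₃ (non-CM E/ℚ of analytic rank 0 with ρ̄_(E,2) surjective,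
ℚ(E[2]) ⊅ ℚ(i), squarefree conductor N with every v_q(Δ_min) odd, ρ̄_(E,2)(G_ℚ₂) ≠ 1 when 2 ∤ N —
the Le Hung–Li mod-2 level-raising habitat — and an imaginary quadratic K with (d_K, 2N) = 1, N =
N⁺N⁻, N⁻ an odd number of inert odd primes, L(E/K,1) ≠ 0):
X_def (GrossPeriodExactnessAtTwo): #Sel_(2^∞)(E/K) = 2^(2·ord₂ ψ_f(P_K)) for the Gross period
ψ_f(P_K) of the definite quaternion algebra ramified at N⁻∞ (the Bertolini–Longo–Venerucci Theorem-B
shape, asked at p = 2);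
X_an (GrossPeriodAnalyticShaAtTwo): the 2-adic Gross formula ord₂ #Ш_an(E/K) = 2·ord₂ ψ_f(P_K);
X_Kato (KatoBoundAtTwo): the one-sided inequality ord₂ #Ш(E′/ℚ)[2^∞] ≤ ord₂ #Ш_an(E′/ℚ) for E′ = E
and its prime-to-2N quadratic twists of analytic rank 0;
X_supply / X_desc (supports): a Gross datum (K, N⁺, N⁻, ψ_f, P_K) with ψ_f(P_K) ≠ 0 exists on H₃,
and Milne's Weil-restriction descent E/K → (E, E^K)/ℚ; X_res: the declared residual (analytic rank 1
or off-habitat). Realises card definite-gross-period-at-two.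
Lean: `GrossPeriodExactnessAtTwo ∧ GrossPeriodAnalyticShaAtTwo ∧ KatoBoundAtTwo ∧
DefiniteGrossDataSupply ∧ DefiniteDescentAtTwo ∧ OffDefiniteHabitatAtTwo`

## Assembly
Pure logic plus the supports: given W on the leaf (non-CM, analytic rank ≤ 1), split on
`W.analyticRank = 0 ∧ H₃(W)`. On the habitat, DefiniteGrossDataSupply produces K and the Gross datum
with ψ_f(P_K) ≠ 0 and r_an(E/K) = 0; GrossPeriodExactnessAtTwo and GrossPeriodAnalyticShaAtTwo give
#Sel_(2^∞)(E/K) = 2^m and ord₂ #Ш_an(E/K) = m with m = 2·ord₂ ψ_f(P_K); KatoBoundAtTwo gives the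
one-sided bounds for E and for the twist by d_K (gcd(d_K, 2N) = 1 is a habitat clause);
DefiniteDescentAtTwo concludes BSDp W 2. Off the habitat, OffDefiniteHabitatAtTwo (residual). The
deciding theorem `closes` in glue.lean is this argument, kernel-checked (Sketch3flat.lean rc 0).

CLOSES_TARGET: closes rung K4 of BirchSwinnertonDyer: Summit.BirchSwinnertonDyer.BirchSwinnertonDyer.Rank1Residual.NonCMAtTwo (D-0061; not the summit Statement) — the deciding theorem of this route concludes that registered leaf instead of the Statement decl `BirchSwinnertonDyer` (class rung: servable and labelled, never counted as concluding the summit Statement).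

Rationale: WHY THIS LINE. Mechanism: on the definite side the whole 2-primary Selmer group of E/K is measured
by ONE integer, the 2-adic valuation of the Gross period ψ_f(P_K) = Σ_σ f(σ·P_K) on the Gross points
of the definite Shimura set (Gross1987, BertoliniDarmon2005, arXiv:2306.17784 Thm B for p ≥ 5, tree
fact `BLV2026_card_selmerGroupPInfty_eq_pow_of_grossPeriod_of_surjective` with `RevisedHypothesis` 5
≤ p); the intended proof of X_def at 2 is a bipartite Euler system (Howard2006) whose auxiliary
primes are the Le Hung–Li mod-2 level-raising primes (arXiv:1501.01344 Thm 14/15: Frob_q of order ≤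
2 on E[2], sign-prescribed) instead of Bertolini–Darmon admissible primes (which do not exist at 2:
`BertoliniDarmon2005.not_isAdmissiblePrime_two`), closed by a rigidity step
(compactness–contradiction card of this seat: a 2^k-Selmer module locally free of rank one at every
vertex of the level-raising graph is determined by one vertex value, Howard2006 §2.3/§3.3) plus
mod-2 primitivity of the Gross value.
X_an imports the automorphic side (Gross–Waldspurger special-value formula with the explicit
constants of CaiShuTian2014 and the congruence-number bookkeeping of WZhang2014 Thm 6.4, here at 2:
Manin constant Cesnavicius2018, degree vs congruence number
AgasheRibetStein2012/RibetTakahashi1997). X_Kato is Kato2004 Thm 17.4 / MazurRubin2004 read at p = 2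
under surjective ρ̄_(E,2) and a multiplicative prime (the τ-element), for E and for its prime-to-2N
twists (same habitat). Imported areas: automorphic forms on definite quaternion algebras
(Jacquet–Langlands, Waldspurger1985, BumpFriedbergHoffstein1990/FriedbergHoffstein1995 for the
choice of K), Galois cohomology (bipartite Euler systems), descent (doi:10.1007/BF01405166 Milne
1972).
What it does that listed routes do not: every p = 2 route on the formula axis is either
congruence/θ-transport over ℚ (ResidualThetaTransportAtTwo, AlignedTransportAtTwo,
EisensteinDepletionAtTwo, TargetPropertiesAtTwo(Plus), 2adic GVT), reduction-type Iwasawa theory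
over ℚ (ByReductionTypeAtTwo), explicit-family Heegner-index bookkeeping (SylvesterTwoHeegnerIndex,
PrintCf2, ShaPrimaryTransfer) or INDEFINITE Heegner–Kolyvagin exactness (GenusKolyvaginAtTwo,
CMKolyvaginAtInertTwo); none uses Gross points / the definite quaternion algebra, and the definite
side needs no rank-1 twin, no Heegner point and no p-adic height — it attacks the 3 096 rank-0 cells
with 16 ∣ #Ш_an directly. The p = 5 sibling
`Summit.BirchSwinnertonDyer.Rank1Residual.X9.DefiniteGrossPeriodRoute` is a UNIT-period special case
at p = 5; here p = 2 and the period is NOT a unit (that is the point: 16 ∣ #Ш). Negatives index: no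
refuted statement concerns Gross periods, definite algebras or p = 2 Selmer cardinalities over K.

RANKED CRUXES. #2 GrossPeriodExactnessAtTwo (crux) — [C1, card K1] For non-CM E/ℚ on the definite
habitat H₃, K and a Gross datum (N⁺, N⁻, definite quaternion algebra B = (a,b)_ℚ with Eichler order
O, optimal embedding ψ : K → B, Brandt eigenvector φ of f_E, class-group representatives, i.e.
`GrossPointData`) with Gross period ψ_f(P_K) = `grossPeriod` ≠ 0: #Sel_(2^∞)(E/K) = 2^(2·ord₂
ψ_f(P_K)). Printed for p ≥ 5 (BLV 2026 Thm B [corpus:paper:arxiv-2306.17784 p.3 'p ⩾ 5']); asked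
here AT p = 2. [difficulty: XL] (why it might fail: Printed proofs (BertoliniDarmon2005, Howard2006
p>3, WZhang2014 p≥5, BLV p≥5) use BD-admissible primes, EMPTY at 2 (not_isAdmissiblePrime_two), and
freeness/multiplicity one mod p; at 2 mult-one can fail (Kilford–Wiese) and #Sel may exceed 2^(2
ord₂ψ) by a level-raising defect.) [arXiv:2306.17784, Howard2006, BertoliniDarmon2005, WZhang2014,
arXiv:1501.01344, arXiv:1908.09512, arXiv:math/0612317]
#3 GrossPeriodAnalyticShaAtTwo (crux) — [C2, card K2] Same habitat and Gross datum: the analytic Ш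
of E/K (`analyticSha (W.baseChange K)` = L(E/K,1)/(Ω·Reg·∏c_v·#tors⁻²), a rational number here) has
2-adic valuation exactly 2·ord₂ ψ_f(P_K) — the 2-part of Gross's special-value formula L(E/K,1) =
(f,f)/(u_K² √|d_K|) · |ψ_f(P_K)|²/deg-type constants, with the Tamagawa numbers at N⁻ (odd on H₃),
the torsion (E(K)[2] = 0 on H₃), the Manin constant and the congruence-number/degree ratio at 2 all
accounted for. [difficulty: L] (why it might fail: Gross's formula is printed up to 2-powers/units
(Gross1987 §11; CaiShuTian2014 explicit constants carry 2^? factors); at 2 ∣ N the Manin constant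
(Cesnavicius2018) and deg φ vs congruence number (AgasheRibetStein2012, RibetTakahashi1997) are not
controlled; u_K, c_v parity must match exactly.) [Gross1987, CaiShuTian2014, WZhang2014,
Cesnavicius2018, AgasheRibetStein2012, RibetTakahashi1997, PollackWeston2011]
#4 KatoBoundAtTwo (crux) — [C3, card K3] For non-CM E/ℚ on H₃ with analytic rank 0: Ш(E/ℚ)[2^∞] is
finite and ord₂ #Ш(E/ℚ)[2^∞] ≤ ord₂ #Ш_an(E/ℚ) (`shaAn`), and the same for every globally minimal
model of a quadratic twist E^d with (d, 2N) = 1 of analytic rank 0 (twist-stable one-sided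
divisibility at 2: Kato's Euler system + Kolyvagin-system bound at p = 2 under surjective ρ̄_(E,2)
and a multiplicative prime supplying τ). [difficulty: L] (why it might fail: Kato2004 Thm 17.4 /
Rubin2000 Thm 2.2.2 assume p ≠ 2: at 2 the Chebotarev choice of Kolyvagin primes, the
Cassels–Tate/Flach pairing sign and the local condition at 2 (2-adic Coleman map when 2 | N
multiplicative) need re-proof; f1-sign2 K2 probes saw 2-power anomalies.) [Kato2004, Rubin2000,
MazurRubin2004, arXiv:2203.12157, arXiv:1709.05780]
#5 OffDefiniteHabitatAtTwo (crux) — [R, residual — declared complement, not attacked by this line]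
BSD_2 for non-CM E/ℚ of analytic rank ≤ 1 OFF the definite habitat: analytic rank 1, or ρ̄_(E,2) not
surjective, or ℚ(E[2]) ⊇ ℚ(i), or N not squarefree, or some v_q(Δ_min) even, or (2 ∤ N and E[2]
unramified-trivial at 2). This is the part of the leaf the line does NOT reduce; it is served to
nobody by this route and is listed so that `closes` is honest. [difficulty: open-problem] (why it
might fail: It is an open problem containing most of the leaf (all rank-1 cells, all 4 | N cells);
declared residual so the tribunal reads the line as H₃-conditional progress on K4, not as a claim on
it.) [arXiv:1010.2431, Kolyvagin1989, GrossZagier1986, arXiv:1501.01344]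
#9 DefiniteGrossDataSupply (support) — [S, card P1] Supply of the Gross datum on H₃ in analytic rank
0: there is an imaginary quadratic K with (d_K, 2N) = 1 and a factorisation N = N⁺N⁻ (N⁻ = product
of the primes inert in K, odd in number, all odd) such that L(E/K, s) does not vanish at s = 1
(BumpFriedbergHoffstein1990 / FriedbergHoffstein1995 non-vanishing of quadratic twists with
prescribed local behaviour; analytic rank of E/K = r_an(E) + r_an(E^K) = 0), together with
`GrossPointData` (Eichler order of level N⁺ in the definite quaternion algebra of discriminant N⁻,
an optimal embedding of O_K — exists since every q | N⁺ splits and every q | N⁻ is inert — the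
Jacquet–Langlands/Brandt eigenvector of f_E) and ψ_f(P_K) ≠ 0 (Gross–Waldspurger: ψ_f(P_K)² ≐
L(E/K,1) ≠ 0). [difficulty: M] [Gross1987, Waldspurger1985, BumpFriedbergHoffstein1990,
FriedbergHoffstein1995, arXiv:2306.17784]
#9 DefiniteDescentAtTwo (support) — [D, card P2] Descent K → ℚ at 2: if E/ℚ and E/K have analytic
rank 0, #Sel_(2^∞)(E/K) = 2^m and ord₂ #Ш_an(E/K) = m, and the one-sided bounds ord₂ #Ш[2^∞] ≤ ord₂
#Ш_an hold for E/ℚ and for (a globally minimal model of) E^(d_K)/ℚ, then BSD_2(E/ℚ). Proof sketch: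
rank E(K) = 0 (Kolyvagin/Kato from L(E/K,1) ≠ 0, or from finiteness of Sel), so #Ш(E/K)[2^∞] = 2^m =
2-part of #Ш_an(E/K); Milne 1972 (Weil restriction, tree
`Milne1972.WeilRestrictionQuadraticBSDQuotient…`) gives #Ш_an(E/K) = #Ш_an(E)·#Ш_an(E^K) up to the
2-power-free isogeny bookkeeping already in `BSDQuotientOverNumberField`, and Ш(E/K)[2^∞] ⊇-counts
Ш(E)[2^∞] ⊕ Ш(E^K)[2^∞] up to the kernel/cokernel of restriction–corestriction, which is
2-torsion-free-controlled when E(K)[2] = 0 (H₃: ρ̄ surjective); two one-sided inequalities summing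
to an equality are equalities. [difficulty: M] [doi:10.1007/BF01405166, Kolyvagin1989,
arXiv:1010.2431, Kato2004]

TWO-LAYER PLAN. Foreseen split of GrossPeriodExactnessAtTwo (once a prover claims it): C1 ⇐ C1a →
C1b → C1 with C1a = one-sided divisibility #Sel_(2^∞)(E/K) | 2^(2 ord₂ ψ) (bipartite Euler system at
2 from Le Hung–Li level-raising primes: first/second reciprocity laws of Bertolini–Darmon at p = 2)
and C1b = the reverse divisibility (rigidity of locally-free-of-rank-one 2^k-Selmer modules on the
level-raising graph + mod-2 primitivity of the Gross value at one vertex); glue = Nat.dvd_antisymm.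
Foreseen split of KatoBoundAtTwo: Kolyvagin-system bound at 2 (MazurRubin2004 with (H.τ) from a
multiplicative prime) + explicit reciprocity law at 2 (Kato2004 §16 is prime-independent).

KILL CRITERIA. Refutation of GrossPeriodExactnessAtTwo by ONE habitat instance (a certified cell
with #Sel_(2^∞)(E/K) ≠ 2^(2 ord₂ ψ_f(P_K)), e.g. via 2-descent over K in Magma/PARI vs ENGINE A/B
Gross period) closes the route `refuted:GrossPeriodExactnessAtTwo` unless the defect is a fixed
habitat-computable 2-power (then restate, misstated class). Refutation of
GrossPeriodAnalyticShaAtTwo by one cell (PARI L-values vs Gross period) forces a pivot to an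
explicit correction factor (Manin/congruence number) or closes the route. A proof elsewhere of BSD_2
in rank 0 for semistable non-CM curves with surjective ρ̄_(E,2) (e.g. ByReductionTypeAtTwo
multiplicative branch + a 2-adic IMC) moots the line.

NOT DECOMPOSED YET. The bipartite-Euler-system internals of C1 (reciprocity laws at 2, the local
condition at 2, freeness of the level-raised Selmer modules, the choice n-admissible ↦ Le Hung–Li
prime with sign), the exact constant bookkeeping of C2 (u_K, Manin constant, deg/congruence number,
c_v at N⁻), and the Kolyvagin-system hypotheses of C3 at p = 2 are deliberately NOT items: they are
layer-2 children after a prover claims the parent (D-0019).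

CHEAPEST FALSIFIER. INSTRUMENT ROW (refutes C1/C2 jointly on one cell): take the smallest WALL row-1
cell inside H₃ with 16 | #Ш_an(E/ℚ) and 4 ∤ N (N squarefree, all v_q(Δ) odd, ρ̄_(E,2) ≅ S₃ —
LMFDB/Cremona labels with `nonmax_primes` ∌ 2 and squarefree conductor, e.g. the 16 | Ш_an
semistable optimal curves of conductor < 10⁴ such as 1058d1/1246b1-type cells, to be picked by the
refuter from WALL-TABLE v1.31 row 1), choose K = ℚ(√−ℓ) with ℓ ∤ 2N prime, an odd number of the
prime factors of N inert, L(E^(−ℓ),1) ≠ 0; run X9 ENGINE A (`grossA.py`, Brandt module of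
discriminant N⁻, level N⁺) or ENGINE B (`engineB.gp`) to get ψ_f(P_K) ∈ ℤ exactly, and PARI
`ellanalyticrank`/`ellbsd` for #Ш_an(E)·#Ш_an(E^(−ℓ)); the line predicts 2·ord₂ ψ_f(P_K) =
ord₂(#Ш_an(E)·#Ш_an(E^K)) (after the fixed Milne bookkeeping) and, with a 2-power descent over K
(Magma `TwoPowerIsogenyDescentRankBound`/`MordellWeilShaInformation`), #Sel_(2^∞)(E/K) = 2^(2 ord₂
ψ). One mismatch not explained by a habitat-computable constant kills the crux. Not run by me this
cycle (kit nodes lack elldata; the X9 engines live in HOME/code/b2b-bsdres-x9/g24/).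

NUMBERS. Residue attacked: WALL-TABLE v1.31 row 1 (K4 leaf NonCMAtTwo): 3 096 analytic-rank-0 cells,
all with 16 | #Ш_an, + 20 rank-1 cells (the rank-1 cells are in the residual of this line). Printed
thresholds: BLV Theorem B needs p ≥ 5, p ∤ N·h_K, ρ̄ surjective [corpus:paper:arxiv-2306.17784 p.3];
Howard's bipartite rigidity needs p > 3, p ∤ 6 d_K N [corpus:paper:arxiv-1202.6353 p.3, p.5, p.12];
W. Zhang's Kolyvagin conjecture proof needs p ≥ 5 [corpus:paper:doi-10-4171-owr-2023-28 p.27 'p ≠ 2,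
3']; Le Hung–Li level raising mod 2 needs exactly the habitat clauses (1)–(4) of their Assumption 7
[corpus:paper:arxiv-1501.01344 p.6].

DEFINITION REQUESTS. None new: `GrossPointData`, `grossPeriod`, `selmerGroupPInfty`, `analyticSha`,
`BSDp`, `shaAn`, `HasSurjectiveModNGaloisRep`, `geomTorsion`, `quadraticTwist` all exist (lean
search --decl run 2026-08-27). Cite facts wanted later by provers: Howard 2006 Thm 3.2.3 (bipartite
ES ⇒ one divisibility) and Le Hung–Li 2016 Thm 14/15 as named Literature facts (not filed by this
seat: ideator units may not `workitem add --kind cite`).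

Novelty: Searches (2026-08-27): lit search --hybrid "Gross period Selmer group p = 2 definite quaternion" (10
generic hits: burns2007, editornd-l-functions-arithmetic p.276 Gross 'Kolyvagin's work',
delbourgo2008); lit vsearch "cardinality of the 2-primary Selmer group equals the square of the
Gross period" (8 hits, none at p = 2); lit search "bipartite Euler system elliptic curve level
raising" --source all (local 10: arXiv:1202.6353 Howard, arXiv:1908.09512 BCK p>3, arXiv:2306.17784
BLV p≥5, arXiv:2311.03100, arXiv:2603.12357, arXiv:2603.22483, arXiv:2509.16881, OWR 2023/28;
remote: openalex/s2 429, crossref noise); lit search "level raising mod 2 Selmer rank elliptic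
curves" --source all (arXiv:1501.01344 Le Hung–Li, doi:10.1093/imrn/rnx188 Chao Li,
doi:10.1017/fms.2019.9 Kriz–Li); lit galaxy search --star all "bipartite Euler system" (0), "level
raising mod 2" (0), "2-part of the Birch" (0), "Gross points|Gross period" (6 irrelevant pdf hits);
lean search grossPeriod / GrossPointData (tree: BLV2026 files, X9 DefiniteGrossPeriodRoute p = 5
only; rg grossPeriod in Theses/*Two* = 0).
Nearest prior art found: arXiv:2306.17784 (Bertolini–Longo–Venerucci 2026, Thm B: #Sel_(p^∞)(E/K) =
p^(2 ord_p ψ) for p ≥ 5, p ∤ N h_K, ρ̄ onto); WZhang2014 (Kolyvagin conjecture + BSD_p formula in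
rank ≤ 1 for p ≥ 5 via level raising on the definite/indefinite pair); arXiv:1501.01344 (Le Hung–Li
2016: level raising mod 2 with prescribed sign and 2-Selmer rank — the supply of auxiliary primes at
2, used  [refs: 10.1093/imrn/rnx188, 10.1017/fms.2019.9, 1202.6353, 1908.09512, 2306.17784, 2311.03100, 2603.12357, 2603.22483, 2509.16881, 1501.01344, doi:10.1093/imrn/rnx188, doi:10.1017/fms.2019.9, WZhang2014]

Barriers (technique_class: euler-system, level-raising, definite-quaternion, rigidity): - technique_class: euler-system, level-raising, definite-quaternion, rigidity
- Literature.Barriers.BirchSwinnertonDyer.NoAdmissiblePrimesAtThree: C1 sits INSIDE this class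
(bipartite ES from level raising) and the barrier's hypothesis is exactly violated on purpose: it
quantifies over Bertolini–Darmon n-admissible primes (`IsAdmissiblePrime`, clause p ∤ ℓ² − 1, empty
at p = 2 by `not_isAdmissiblePrime_two`); the line's auxiliary primes are Le Hung–Li level-raising
primes (Frob_q of order ≤ 2 on E[2], q with prescribed sign), whose existence at 2 is a THEOREM
[corpus:paper:arxiv-1501.01344 p.6 Thm 14/15]; the bet is that Howard's rigidity survives the
eigenvalue collision ε_q = ±1 ≡ 1 mod 2 (honest risk, = C1's why-it-might-fail).
- Literature.Barriers.BirchSwinnertonDyer.EulerSystemBigImageBarrier: outside — H₃ demands ρ̄_(E,2)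
SURJECTIVE and a multiplicative prime with odd v_q(Δ) (a transvection), so the big-image/τ
hypotheses of Kato2004/MazurRubin2004 hold; the barrier quantifies over irreducible NON-surjective
images only (C3, C1).
- Literature.Barriers.BirchSwinnertonDyer.AdditiveIwasawaTheoryAtTwoBarrier: outside — the line
works at finite level over K and ℚ (no Λ, no μ-invariant, no signed Coleman maps); the file's two
entries (SignedIwasawaTheoryAtTwoBarrier, AdditiveIwasawaTheoryAtTwoBarrier) concern cyclotomic
towers; C3 needs Kato's finite-level bound only (for 2 | N the curve is multiplicative at 2 on H₃,
never additive).
- Literature.Barriers.BirchSwinnertonDyer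

History (route lifecycle, newest last):
- 2026-08-28T03:32:24Z · rev 2: restated DefiniteMultiplicityOneAtTwo (stmt-BirchSwinnertonDyer-24586) — REPAIR after instrument BRANDT2 (jobs j297049, j297783, j297943 FULL table 243 rows, j298121 Kilford controls): K1 as typed (anemic Hecke algebra, p coprime to (planner-bsd-idea-1-g3-0)
- 2026-08-28T03:33:37Z · rev 3: restated RibetTakahashiAtTwo (stmt-BirchSwinnertonDyer-24587) — REPAIR companion of rev 2: K2's mod-2 multiplicity-one HYPOTHESIS now refers to the FULL Hecke algebra (p coprime to N+N- instead of 2N+N-), matching the restat (planner-bsd-idea-1-g3-0)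

sub-problem: BirchSwinnertonDyer · status: open · opened planner-bsd-idea-1-g2-0 2026-08-27T23:31:53Z · rev 8 · ledger route-BirchSwinnertonDyer-DefiniteGrossPeriodAtTwo
GENERATED by the gate from the ledger (D-0016/17). Provers cite these decls: `theorem foo : Summit.BirchSwinnertonDyer.BirchSwinnertonDyer.Theses.DefiniteGrossPeriodAtTwo.<Decl> := …` in Summits/BirchSwinnertonDyer/BirchSwinnertonDyer/Theorems/<Name>.lean.
-/

namespace Summit.BirchSwinnertonDyer.BirchSwinnertonDyer.Theses.DefiniteGrossPeriodAtTwo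

open scoped BigOperators Topology Manifold Classical MeasureTheory ProbabilityTheory Matrix InnerProductSpace ComplexConjugate ContinuousMap
open Filter Set Function TopologicalSpace MeasureTheory

attribute [summit_statement] _root_.BirchSwinnertonDyer
attribute [summit_statement] _root_.Summit.BirchSwinnertonDyer.BirchSwinnertonDyer.Rank1Residual.NonCMAtTwo

open Literature

/-! Retired items kept as plain definitions (history; not obligations of this route): landed proofs / closed glue still name them. -/

/-- retired stmt-BirchSwinnertonDyer-19922 (retired, gen 1) — named by an active item. -/
def MultUpperHalfAtTwo : Prop :=
  ∀ (W : WeierstrassCurve ℚ) [W.IsElliptic] [W.IsGloballyMinimal], ¬ W.HasCM → W.analyticRank = 0 → Literature.NumberTheory.EllipticCurves.Rank1Residual.Mult W 2 → Literature.NumberTheory.EllipticCurves.Rank1Residual.Typed.MissingUpperBoundAt W 2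

/-- retired stmt-BirchSwinnertonDyer-27845 (retired, gen 1) — named by an active item. -/
def OrdUpperHalfAtTwo : Prop :=
  ∀ (W : WeierstrassCurve ℚ) [W.IsElliptic] [W.IsGloballyMinimal], ¬ W.HasCM → W.analyticRank = 0 → Literature.NumberTheory.EllipticCurves.Rank1Residual.GoodOrd W 2 → Literature.NumberTheory.EllipticCurves.Rank1Residual.Typed.MissingUpperBoundAt W 2

/-- retired stmt-BirchSwinnertonDyer-27846 (retired, gen 1) — named by an active item. -/
def SupersingularUpperHalfAtTwo : Prop :=
  ∀ (W : WeierstrassCurve ℚ) [W.IsElliptic] [W.IsGloballyMinimal], ¬ W.HasCM → W.analyticRank = 0 → Literature.NumberTheory.EllipticCurves.Rank1Residual.GoodSS W 2 → Literature.NumberTheory.EllipticCurves.Rank1Residual.Typed.MissingUpperBoundAt W 2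

/-- retired stmt-BirchSwinnertonDyer-27847 (retired, gen 1) — named by an active item. -/
def AdditiveUpperHalfAtTwo : Prop :=
  ∀ (W : WeierstrassCurve ℚ) [W.IsElliptic] [W.IsGloballyMinimal], ¬ W.HasCM → W.analyticRank = 0 → Literature.NumberTheory.EllipticCurves.Rank1Residual.Addv W 2 → Literature.NumberTheory.EllipticCurves.Rank1Residual.Typed.MissingUpperBoundAt W 2

/-- item stmt-BirchSwinnertonDyer-23664 · crux · rank 2 · SPLIT (gen 1) into GrossPeriodUnitRigidityAtTwo, GrossPeriodExactnessAtTwoEven + glue GrossPeriodExactnessAtTwoGlue · direct attempts still welcome (low priority) · by planner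
why it might fail: Printed proofs (BertoliniDarmon2005, Howard2006 p>3, WZhang2014 p≥5, BLV p≥5) use BD-admissible primes, EMPTY at 2 (not_isAdmissiblePrime_two), and freeness/multiplicity one mod p; at 2 mult-one can fail (Kilford–Wiese) and #Sel may exceed 2^(2 ord₂ψ) by a level-raising defect.
sources: arXiv:2306.17784, Howard2006, BertoliniDarmon2005, WZhang2014, arXiv:1501.01344, arXiv:1908.09512
[crux] [C1, card K1] For non-CM E/ℚ on the definite habitat H₃, K and a Gross datum (N⁺, N⁻,
definite quaternion algebra B = (a,b)_ℚ with Eichler order O, optimal embedding ψ : K → B, Brandt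
eigenvector φ of f_E, class-group representatives, i.e. `GrossPointData`) with Gross period ψ_f(P_K)
= `grossPeriod` ≠ 0: #Sel_(2^∞)(E/K) = 2^(2·ord₂ ψ_f(P_K)). Printed for p ≥ 5 (BLV 2026 Thm B
[corpus:paper:arxiv-2306.17784 p.3 'p ⩾ 5']); asked here AT p = 2. [difficulty: XL] -/
@[route_item "route-BirchSwinnertonDyer-DefiniteGrossPeriodAtTwo", crux]
def GrossPeriodExactnessAtTwo : Prop :=
  ∀ (W : WeierstrassCurve ℚ) [W.IsElliptic] [W.IsGloballyMinimal] (Nplus Nminus : ℕ) (a b : ℚ) (O : Subring (QuaternionAlgebra ℚ a 0 b)) (K : Type) [Field K] [NumberField K] (ψ : K →ₐ[ℚ] QuaternionAlgebra ℚ a 0 b) (I : Submodule ℤ (QuaternionAlgebra ℚ a 0 b)) (φ : Submodule ℤ (QuaternionAlgebra ℚ a 0 b) → ℤ) (rep : ClassGroup (NumberField.RingOfIntegers K) → nonZeroDivisors (Ideal (NumberField.RingOfIntegers K))) (RI : Set (Submodule ℤ (QuaternionAlgebra ℚ a 0 b))) (IsEig : (Submodule ℤ (QuaternionAlgebra ℚ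 a 0 b) → ℤ) → Prop), ¬ W.HasCM → (W.HasSurjectiveModNGaloisRep (2 : ℤ) ∧ ¬ IsSquare (-(W.Δ)) ∧ Squarefree (W.conductorNorm ℤ) ∧ (∀ q ∈ (W.conductorNorm ℤ).primeFactors, Odd ((W.minimalDiscriminantNorm ℤ).factorization q)) ∧ (¬ 2 ∣ W.conductorNorm ℤ → ∃ v : IsDedekindDomain.HeightOneSpectrum (NumberField.RingOfIntegers ℚ), ((2 : ℕ) : NumberField.RingOfIntegers ℚ) ∈ v.asIdeal ∧ ∃ 𝔓 ∈ v.primesAbove, ∃ σ ∈ 𝔓.decompositionSubgroup (Field.absoluteGaloisGroup ℚ), ∃ P : W.geomTorsion (2 : ℤ), σ • P ≠ P)) → (Module.finrank ℚ K = 2 ∧ NumberField.IsTotallyComplex K ∧ Int.gcd (NumberField.discr K) (W.conductorNorm ℤ * 2) = 1 ∧ W.conductorNorm ℤ = Nplus * Nminus ∧ Nat.Coprime Nplus Nminus ∧ ¬ 2 ∣ Nminus ∧ Odd Nminus.primeFactors.card ∧ (∀ q : ℕ, q.Prime → q ∣ Nplus → ((Ideal.span {(q : ℤ)}).primesOver (NumberField.RingOfIntegers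 K)).ncard = 2) ∧ (∀ q : ℕ, q.Prime → q ∣ Nminus → ((Ideal.span {(q : ℤ)}).primesOver (NumberField.RingOfIntegers K)).ncard = 1)) → Literature.NumberTheory.EllipticCurves.BertoliniLongoVenerucci2026.GrossPointData W Nplus Nminus a b O K ψ I φ rep RI IsEig → Literature.NumberTheory.EllipticCurves.BertoliniLongoVenerucci2026.grossPeriod K ψ I φ rep ≠ 0 → Nat.card ((W.baseChange K).selmerGroupPInfty 2) = 2 ^ (2 * padicValInt 2 (Literature.NumberTheory.EllipticCurves.BertoliniLongoVenerucci2026.grossPeriod K ψ I φ rep))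

-- parent: GrossPeriodExactnessAtTwo · child (gen 1)
/--     item stmt-BirchSwinnertonDyer-26983 · crux · rank 201 · open
    parent: GrossPeriodExactnessAtTwo · by planner
    why it might fail: Level raising mod 4 at depth-2 Kolyvagin primes with prescribed sign and the mod-4 first reciprocity law are unprinted at p=2 (Ribet/DT/BD need p>=5 or mult-one; Kilford-Wiese); the last bit needs non-Kolyvagin primes; psi odd vs L-unit may differ by w_i,u_K at 2.
    sources: arXiv:2306.17784, BertoliniDarmon2005, WZhang2014, GrossLMS1991, McCallumLMS1991, Kolyvagin1991
[crux] [C1u, LINE 7 of ideator seat bsd-idea-1 g4; technique card rigidity / annihilation pincer;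
bears_on W-ALL row 1 = K4 leaf Rank1Residual.NonCMAtTwo via DGP binder h1] UNIT RIGIDITY on the
definite habitat: for non-CM E/Q on H3 (rho-bar_{E,2} surjective, -Delta non-square, N squarefree,
odd v_q(Delta_min), 2-distinguished), K as in C1 and a Gross datum, an ODD Gross period psi_f(P_K)
forces Sel_(2^infty)(E/K) = 0 (so #Sel = 1 = 2^(2*0)). Mechanism (beyond print at p = 2, where
BD-admissible primes do not exist, `not_isAdmissiblePrime_two`): Kolyvagin primes of DEPTH 2 (l
inert in K, Frob_l = tau in K(E[4])/Q) admit level raising mod 4 in BOTH signs (a_l == l+1 == 0 mod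
4); the sign -1 class kappa(l) in H^1(K,E[4]) has unit singular residue in (1-tau)E[4] iff psi is
odd (first reciprocity law mod 4), and e_4((1+tau)a, 1-tau) = -2a.zeta makes the Poitou-Tate pincer
see loc_lambda(Sel_4) modulo 2E[4]: Chebotarev then gives exponent 2 (first bit); the last bit uses
twisted auxiliary primes (Frob_l on E[2] a transposition other than tau) and the mod-2 law in the
Frobenius-fixed line. No freeness / multiplicity-one of the full Hecke module mod 2 is used beyond
the phi-line; no count -/
@[route_item "route-BirchSwinnertonDyer-DefiniteGrossPeriodAtTwo"]
def GrossPeriodUnitRigidityAtTwo : Prop :=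
  ∀ (W : WeierstrassCurve ℚ) [W.IsElliptic] [W.IsGloballyMinimal] (Nplus Nminus : ℕ) (a b : ℚ) (O : Subring (QuaternionAlgebra ℚ a 0 b)) (K : Type) [Field K] [NumberField K] (ψ : K →ₐ[ℚ] QuaternionAlgebra ℚ a 0 b) (I : Submodule ℤ (QuaternionAlgebra ℚ a 0 b)) (φ : Submodule ℤ (QuaternionAlgebra ℚ a 0 b) → ℤ) (rep : ClassGroup (NumberField.RingOfIntegers K) → nonZeroDivisors (Ideal (NumberField.RingOfIntegers K))) (RI : Set (Submodule ℤ (QuaternionAlgebra ℚ a 0 b))) (IsEig : (Submodule ℤ (QuaternionAlgebra ℚ a 0 b) → ℤ) → Prop), ¬ W.HasCM → (W.HasSurjectiveModNGaloisRep (2 : ℤ) ∧ ¬ IsSquare (-(W.Δ)) ∧ Squarefree (W.conductorNorm ℤ) ∧ (∀ q ∈ (W.conductorNorm ℤ).primeFactors, Odd ((W.minimalDiscriminantNorm ℤ).factorization q)) ∧ (¬ 2 ∣ W.conductorNorm ℤ → ∃ v : IsDedekindDomain.HeightOneSpectrum (NumberField.RingOfIntegers ℚ), ((2 : ℕ) :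 NumberField.RingOfIntegers ℚ) ∈ v.asIdeal ∧ ∃ 𝔓 ∈ v.primesAbove, ∃ σ ∈ 𝔓.decompositionSubgroup (Field.absoluteGaloisGroup ℚ), ∃ P : W.geomTorsion (2 : ℤ), σ • P ≠ P)) → (Module.finrank ℚ K = 2 ∧ NumberField.IsTotallyComplex K ∧ Int.gcd (NumberField.discr K) (W.conductorNorm ℤ * 2) = 1 ∧ W.conductorNorm ℤ = Nplus * Nminus ∧ Nat.Coprime Nplus Nminus ∧ ¬ 2 ∣ Nminus ∧ Odd Nminus.primeFactors.card ∧ (∀ q : ℕ, q.Prime → q ∣ Nplus → ((Ideal.span {(q : ℤ)}).primesOver (NumberField.RingOfIntegers K)).ncard = 2) ∧ (∀ q : ℕ, q.Prime → q ∣ Nminus → ((Ideal.span {(q : ℤ)}).primesOver (NumberField.RingOfIntegers K)).ncard = 1)) → Literature.NumberTheory.EllipticCurves.BertoliniLongoVenerucci2026.GrossPointData W Nplus Nminus a b O K ψ I φ rep RI IsEig → Odd (Literature.NumberTheory.EllipticCurves.BertoliniLongoVenerucci2026.grossPeriod K ψ I φ rep) → Nat.card ((W.baseChange K).selmerGroupPInfty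 2) = 1

-- parent: GrossPeriodExactnessAtTwo · child (gen 1)
/--     item stmt-BirchSwinnertonDyer-26984 · crux · rank 202 · open
    parent: GrossPeriodExactnessAtTwo · by planner
    why it might fail: As C1: the induction needs freeness of the level-raised character lattice over the Hecke algebra and a zero level-raising defect mod 2^M at each step; at 2 the defect can be positive (Kilford-Wiese non-Gorenstein T_m), making #Sel exceed 2^(2 ord_2 psi).
    sources: arXiv:2306.17784, BertoliniDarmon2005, WZhang2014, GrossLMS1991, McCallumLMS1991, Kolyvagin1991
[crux] [C1e, LINE 7 remainder] C1 `GrossPeriodExactnessAtTwo` in the EVEN-period regime 2 |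
psi_f(P_K) != 0: #Sel_(2^infty)(E/K) = 2^(2 ord_2 psi). This is the XL part of C1 (the full
bipartite Euler-system induction at 2: both reciprocity laws mod 2^(M+1) with M = ord_2 psi + 1 at
depth-(M+1) Kolyvagin primes, and a rank-lowering step with control of the level-raising defect),
isolated so that the unit case C1u can close first and so that its depth-2 devices are tested before
the induction is attempted. bears_on W-ALL row 1 (K4 leaf NonCMAtTwo) via DGP h1. No summit is
proved by this line. -/
@[route_item "route-BirchSwinnertonDyer-DefiniteGrossPeriodAtTwo"]
def GrossPeriodExactnessAtTwoEven : Prop :=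
  ∀ (W : WeierstrassCurve ℚ) [W.IsElliptic] [W.IsGloballyMinimal] (Nplus Nminus : ℕ) (a b : ℚ) (O : Subring (QuaternionAlgebra ℚ a 0 b)) (K : Type) [Field K] [NumberField K] (ψ : K →ₐ[ℚ] QuaternionAlgebra ℚ a 0 b) (I : Submodule ℤ (QuaternionAlgebra ℚ a 0 b)) (φ : Submodule ℤ (QuaternionAlgebra ℚ a 0 b) → ℤ) (rep : ClassGroup (NumberField.RingOfIntegers K) → nonZeroDivisors (Ideal (NumberField.RingOfIntegers K))) (RI : Set (Submodule ℤ (QuaternionAlgebra ℚ a 0 b))) (IsEig : (Submodule ℤ (QuaternionAlgebra ℚ a 0 b) → ℤ) → Prop), ¬ W.HasCM → (W.HasSurjectiveModNGaloisRep (2 : ℤ) ∧ ¬ IsSquare (-(W.Δ)) ∧ Squarefree (W.conductorNorm ℤ) ∧ (∀ q ∈ (W.conductorNorm ℤ).primeFactors, Odd ((W.minimalDiscriminantNorm ℤ).factorization q)) ∧ (¬ 2 ∣ W.conductorNorm ℤ → ∃ v : IsDedekindDomain.HeightOneSpectrum (NumberField.RingOfIntegers ℚ), ((2 : ℕ) :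 NumberField.RingOfIntegers ℚ) ∈ v.asIdeal ∧ ∃ 𝔓 ∈ v.primesAbove, ∃ σ ∈ 𝔓.decompositionSubgroup (Field.absoluteGaloisGroup ℚ), ∃ P : W.geomTorsion (2 : ℤ), σ • P ≠ P)) → (Module.finrank ℚ K = 2 ∧ NumberField.IsTotallyComplex K ∧ Int.gcd (NumberField.discr K) (W.conductorNorm ℤ * 2) = 1 ∧ W.conductorNorm ℤ = Nplus * Nminus ∧ Nat.Coprime Nplus Nminus ∧ ¬ 2 ∣ Nminus ∧ Odd Nminus.primeFactors.card ∧ (∀ q : ℕ, q.Prime → q ∣ Nplus → ((Ideal.span {(q : ℤ)}).primesOver (NumberField.RingOfIntegers K)).ncard = 2) ∧ (∀ q : ℕ, q.Prime → q ∣ Nminus → ((Ideal.span {(q : ℤ)}).primesOver (NumberField.RingOfIntegers K)).ncard = 1)) → Literature.NumberTheory.EllipticCurves.BertoliniLongoVenerucci2026.GrossPointData W Nplus Nminus a b O K ψ I φ rep RI IsEig → Literature.NumberTheory.EllipticCurves.BertoliniLongoVenerucci2026.grossPeriod K ψ I φ rep ≠ 0 → 2 ∣ Literature.NumberTheory.EllipticCurves.BertoliniLongoVenerucci2026.grossPeriod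 K ψ I φ rep → Nat.card ((W.baseChange K).selmerGroupPInfty 2) = 2 ^ (2 * padicValInt 2 (Literature.NumberTheory.EllipticCurves.BertoliniLongoVenerucci2026.grossPeriod K ψ I φ rep))

-- parent: GrossPeriodExactnessAtTwo · glue (gen 1)
/--     item stmt-BirchSwinnertonDyer-26985 · support · rank 203 · closed · proved by Summit.BirchSwinnertonDyer.BirchSwinnertonDyer.Theorems.DefiniteGrossGlue.grossPeriodExactnessAtTwoGlue_proof (planner)
    parent: GrossPeriodExactnessAtTwo · GLUE: children ⟹ parent · by planner
parity cases on the Gross period: 2 ∣ ψ → C1e; 2 ∤ ψ → Odd ψ and C1u gives #Sel = 1 = 2^(2·0) since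
padicValInt 2 ψ = 0 — proved in the seat folder Sketch7.lean
(grossPeriodExactnessAtTwo_of_unit_of_even), to be landed as
Theorems/DefiniteGrossPeriodAtTwoParitySplit.lean -/
@[route_item "route-BirchSwinnertonDyer-DefiniteGrossPeriodAtTwo"]
def GrossPeriodExactnessAtTwoGlue : Prop :=
  GrossPeriodUnitRigidityAtTwo → GrossPeriodExactnessAtTwoEven → GrossPeriodExactnessAtTwo

-- `GrossPeriodExactnessAtTwoGlue` holds: proved by `Summit.BirchSwinnertonDyer.BirchSwinnertonDyer.Theorems.DefiniteGrossGlue.grossPeriodExactnessAtTwoGlue_proof` (its module imports this route file, so no `_holds` link can be stated here).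

/-- item stmt-BirchSwinnertonDyer-23665 · crux · rank 3 · SPLIT (gen 1) into DefiniteMultiplicityOneAtTwo, RibetTakahashiAtTwo, ExplicitGrossValueAtTwo, ModularitySupply, EvenWeightResidualAtTwo + glue GrossPeriodAnalyticShaAtTwoOfSplit · direct attempts still welcome (low priority) · by planner
why it might fail: Gross's formula is printed up to 2-powers/units (Gross1987 §11; CaiShuTian2014 explicit constants carry 2^? factors); at 2 ∣ N the Manin constant (Cesnavicius2018) and deg φ vs congruence number (AgasheRibetStein2012, RibetTakahashi1997) are not controlled; u_K, c_v parity must match exactly.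
sources: Gross1987, CaiShuTian2014, WZhang2014, Cesnavicius2018, AgasheRibetStein2012, RibetTakahashi1997
retired/moot children: DefiniteMultiplicityOneAtTwo [replaced: ∀ (W : WeierstrassCurve ℚ) [W.IsElliptic] [W.IsGloballyMinimal] (Nplus Nminus : ]; RibetTakahashiAtTwo [replaced: ∀ (W : WeierstrassCurve ℚ) [W.IsElliptic] [W.IsGloballyMinimal] [NeZero (W.condu]
[crux] [C2, card K2] Same habitat and Gross datum: the analytic Ш of E/K (`analyticSha (W.baseChange
K)` = L(E/K,1)/(Ω·Reg·∏c_v·#tors⁻²), a rational number here) has 2-adic valuation exactly 2·ord₂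
ψ_f(P_K) — the 2-part of Gross's special-value formula L(E/K,1) = (f,f)/(u_K² √|d_K|) ·
|ψ_f(P_K)|²/deg-type constants, with the Tamagawa numbers at N⁻ (odd on H₃), the torsion (E(K)[2] =
0 on H₃), the Manin constant and the congruence-number/degree ratio at 2 all accounted for.
[difficulty: L] -/
@[route_item "route-BirchSwinnertonDyer-DefiniteGrossPeriodAtTwo", crux]
def GrossPeriodAnalyticShaAtTwo : Prop :=
  ∀ (W : WeierstrassCurve ℚ) [W.IsElliptic] [W.IsGloballyMinimal] (Nplus Nminus : ℕ) (a b : ℚ) (O : Subring (QuaternionAlgebra ℚ a 0 b)) (K : Type) [Field K] [NumberField K] (ψ : K →ₐ[ℚ] QuaternionAlgebra ℚ a 0 b) (I : Submodule ℤ (QuaternionAlgebra ℚ a 0 b)) (φ : Submodule ℤ (QuaternionAlgebra ℚ a 0 b) → ℤ) (rep : ClassGroup (NumberField.RingOfIntegers K) → nonZeroDivisors (Ideal (NumberField.RingOfIntegers K))) (RI : Set (Submodule ℤ (QuaternionAlgebra ℚ a 0 b))) (IsEig : (Submodule ℤ (QuaternionAlgebra ℚ a 0 b) → ℤ) → Prop),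 ¬ W.HasCM → (W.HasSurjectiveModNGaloisRep (2 : ℤ) ∧ ¬ IsSquare (-(W.Δ)) ∧ Squarefree (W.conductorNorm ℤ) ∧ (∀ q ∈ (W.conductorNorm ℤ).primeFactors, Odd ((W.minimalDiscriminantNorm ℤ).factorization q)) ∧ (¬ 2 ∣ W.conductorNorm ℤ → ∃ v : IsDedekindDomain.HeightOneSpectrum (NumberField.RingOfIntegers ℚ), ((2 : ℕ) : NumberField.RingOfIntegers ℚ) ∈ v.asIdeal ∧ ∃ 𝔓 ∈ v.primesAbove, ∃ σ ∈ 𝔓.decompositionSubgroup (Field.absoluteGaloisGroup ℚ), ∃ P : W.geomTorsion (2 : ℤ), σ • P ≠ P)) → (Module.finrank ℚ K = 2 ∧ NumberField.IsTotallyComplex K ∧ Int.gcd (NumberField.discr K) (W.conductorNorm ℤ * 2) = 1 ∧ W.conductorNorm ℤ = Nplus * Nminus ∧ Nat.Coprime Nplus Nminus ∧ ¬ 2 ∣ Nminus ∧ Odd Nminus.primeFactors.card ∧ (∀ q : ℕ, q.Prime → q ∣ Nplus → ((Ideal.span {(q : ℤ)}).primesOver (NumberField.RingOfIntegers K)).ncard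 = 2) ∧ (∀ q : ℕ, q.Prime → q ∣ Nminus → ((Ideal.span {(q : ℤ)}).primesOver (NumberField.RingOfIntegers K)).ncard = 1)) → Literature.NumberTheory.EllipticCurves.BertoliniLongoVenerucci2026.GrossPointData W Nplus Nminus a b O K ψ I φ rep RI IsEig → Literature.NumberTheory.EllipticCurves.BertoliniLongoVenerucci2026.grossPeriod K ψ I φ rep ≠ 0 → ∃ q : ℚ, Literature.NumberTheory.EllipticCurves.analyticSha (W.baseChange K) = (q : ℂ) ∧ padicValRat 2 q = 2 * padicValInt 2 (Literature.NumberTheory.EllipticCurves.BertoliniLongoVenerucci2026.grossPeriod K ψ I φ rep)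

-- parent: GrossPeriodAnalyticShaAtTwo · child (gen 1)
/--     item stmt-BirchSwinnertonDyer-25334 · crux · rank 301 · open
    parent: GrossPeriodAnalyticShaAtTwo · by planner
    why it might fail: Full-Hecke mod-2 multiplicity one for definite quaternion algebras is not in print: Diamond/Kisin freeness at p=2 lacks local-ring regularity in the supersingular-at-2 sub-cell (a_2 even), and a mod-2 companion with the same T_2-eigenvalue would still force multiplicity 2 (229a needs T_2).
    sources: arXiv:1301.1113, doi:10.4007/annals.2009.170.1085, Kilford2002, doi:10.1215/S0012-7094-97-08715-7
[K1 REPAIRED in place = K1R (full Hecke algebra; decl name kept so the glue 24590 / GlueProof5.lean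
stay valid) · after instrument BRANDT2 (j297049/j297783: K1 as typed — ANEMIC operators p ∤ 2N — is
numerically refuted at (229a1, N⁺=1, N⁻=229): anemic mod-2 multiplicity 2 via a companion dim-6
orbit congruent mod P | 2; with T₂ added multiplicity is 1)] MOD-2 MULTIPLICITY ONE FOR THE FULL
HECKE ALGEBRA of the definite Brandt module B(N⁻; N⁺): on the habitat (non-CM; ρ̄_{E,2} onto
GL₂(𝔽₂); −Δ non-square; N squarefree with ord_q Δ odd at every q | N; 2-DISTINGUISHED: some σ in a
decomposition group at 2 moves a 2-torsion point when 2 ∤ N; N = N⁺N⁻ coprime, N⁻ odd with an odd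
number of prime factors; all monodromy weights odd) the simultaneous eigenspace {x : Cl(O) → 𝔽₂ |
B(p) x = a_p x for ALL primes p ∤ N⁺N⁻} (T₂ INCLUDED when N is odd) has exactly 2 elements. This is
the ring 𝕋_𝔪 of Gross's formula and of Ribet–Takahashi / Pollack–Weston; the 2-distinguished clause
is Buzzard's condition separating the habitat from Kilford's mod-2 multiplicity-two levels 431, 503
(ρ̄ unramified at 2 with scalar Frobenius). SUB-CELLS (critic VERDICT #29 price 1, named not
carved): ORDINARY at 2 (2 -/
@[route_item "route-BirchSwinnertonDyer-DefiniteGrossPeriodAtTwo"]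
def DefiniteMultiplicityOneAtTwo : Prop :=
  ∀ (W : WeierstrassCurve ℚ) [W.IsElliptic] [W.IsGloballyMinimal] (Nplus Nminus : ℕ), ¬ W.HasCM → (W.HasSurjectiveModNGaloisRep (2 : ℤ) ∧ ¬ IsSquare (-(W.Δ)) ∧ Squarefree (W.conductorNorm ℤ) ∧ (∀ q ∈ (W.conductorNorm ℤ).primeFactors, Odd ((W.minimalDiscriminantNorm ℤ).factorization q)) ∧ (¬ 2 ∣ W.conductorNorm ℤ → ∃ v : IsDedekindDomain.HeightOneSpectrum (NumberField.RingOfIntegers ℚ), ((2 : ℕ) : NumberField.RingOfIntegers ℚ) ∈ v.asIdeal ∧ ∃ 𝔓 ∈ v.primesAbove, ∃ σ ∈ 𝔓.decompositionSubgroup (Field.absoluteGaloisGroup ℚ), ∃ P : W.geomTorsion (2 : ℤ), σ • P ≠ P)) → (W.conductorNorm ℤ = Nplus * Nminus ∧ Nat.Coprime Nplus Nminus ∧ ¬ 2 ∣ Nminus ∧ Odd Nminus.primeFactors.card) → (∀ S : Literature.NumberTheory.Automorphic.Brandt.XiSetup Nplus Nminus, ∀ c : Literature.NumberTheory.Automorphic.Brandt.ClassSet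 S.O, Odd (Literature.NumberTheory.Automorphic.Brandt.weight S.O c)) → (∀ (S : Literature.NumberTheory.Automorphic.Brandt.XiSetup Nplus Nminus) [Fintype (Literature.NumberTheory.Automorphic.Brandt.ClassSet S.O)], Nat.card {x : Literature.NumberTheory.Automorphic.Brandt.ClassSet S.O → ZMod 2 // ∀ p : ℕ, p.Prime → ¬ p ∣ Nplus * Nminus → Matrix.mulVec ((Literature.NumberTheory.Automorphic.Brandt.matrix S.O p).map (Int.castRingHom (ZMod 2))) x = ((W.LFunction p : ℤ) : ZMod 2) • x} = 2)

-- parent: GrossPeriodAnalyticShaAtTwo · child (gen 1)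
/--     item stmt-BirchSwinnertonDyer-25356 · crux · rank 302 · open
    parent: GrossPeriodAnalyticShaAtTwo · by planner
    why it might fail: Agashe–Ribet–Stein: p ∣ (congruence number / modular degree) forces p² ∣ 4N, so p = 2 is unconstrained even for odd squarefree N; the 2-adic ξ-identity can be off by that defect or by a Manin-constant / X₀-vs-X₁ switch at 2 unless full-Hecke K1 kills both.
    sources: doi:10.1073/pnas.94.21.11110, doi:10.1006/jnth.2000.2614, arXiv:math/0610694, doi:10.1007/978-1-4419-6211-9_2, arXiv:1604.02165
[K2 REPAIRED in place = K2R: K2 with its multiplicity-one HYPOTHESIS restated for the FULL Hecke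
algebra (p ∤ N⁺N⁻, T₂ included for odd N) so that it consumes K1R; otherwise verbatim 24587.
Instrument BRANDT2: defect ord₂ deg φ_opt − ord₂ ξ(N⁺,N⁻) − Σ_{q|N⁻} ord₂ ord_q Δ = 0 on 63/63
HAB∧odd-weight rows incl. 229a (where only full-𝕋 multiplicity one holds) and 52/52 HAB∧even-weight
rows; 36/180 controls nonzero. NOTE (critic #29): under HAB every q | N has ord_q Δ odd, so Σ_{q|N⁻}
ord₂(ord_q Δ) = 0 and K2R reads ord₂ deg φ = ord₂ ξ(N⁺,N⁻); printed for p ≥ 5 only (Pollack–Weston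
2011 Thm 6.8, Takahashi 2001).] [K2 · rank 3 of the split] The 2-PART of the Ribet–Takahashi /
Pollack–Weston degree formula in the DEFINITE setting: under the K1 hypotheses and mod-2
multiplicity one, for the minimal-degree (optimal) X₀(N)-parametrised curve W₀ with the same newform
as W, ord₂(deg φ_{W₀}) = ord₂ ξ(N⁺,N⁻)(a_•(W)) + Σ_{q | N⁻} ord₂(ord_q Δ_min(W)), where ξ is the
Brandt self-pairing `brandtXi` (Gross's definite 'degree'). Printed only for odd p (PW 2011 Thm 6.8:
p ≥ 5, CR) and, on the indefinite side, exactly when the isogeny class is a single curve (Takahashi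
2001 (V)); the 2-part needs Ribe -/
@[route_item "route-BirchSwinnertonDyer-DefiniteGrossPeriodAtTwo"]
def RibetTakahashiAtTwo : Prop :=
  ∀ (W : WeierstrassCurve ℚ) [W.IsElliptic] [W.IsGloballyMinimal] [NeZero (W.conductorNorm ℤ)] (Nplus Nminus : ℕ), ¬ W.HasCM → (W.HasSurjectiveModNGaloisRep (2 : ℤ) ∧ ¬ IsSquare (-(W.Δ)) ∧ Squarefree (W.conductorNorm ℤ) ∧ (∀ q ∈ (W.conductorNorm ℤ).primeFactors, Odd ((W.minimalDiscriminantNorm ℤ).factorization q)) ∧ (¬ 2 ∣ W.conductorNorm ℤ → ∃ v : IsDedekindDomain.HeightOneSpectrum (NumberField.RingOfIntegers ℚ), ((2 : ℕ) : NumberField.RingOfIntegers ℚ) ∈ v.asIdeal ∧ ∃ 𝔓 ∈ v.primesAbove, ∃ σ ∈ 𝔓.decompositionSubgroup (Field.absoluteGaloisGroup ℚ), ∃ P : W.geomTorsion (2 : ℤ), σ • P ≠ P)) → (W.conductorNorm ℤ = Nplus * Nminus ∧ Nat.Coprime Nplus Nminus ∧ ¬ 2 ∣ Nminus ∧ Odd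 Nminus.primeFactors.card) → (∀ S : Literature.NumberTheory.Automorphic.Brandt.XiSetup Nplus Nminus, ∀ c : Literature.NumberTheory.Automorphic.Brandt.ClassSet S.O, Odd (Literature.NumberTheory.Automorphic.Brandt.weight S.O c)) → (∀ (S : Literature.NumberTheory.Automorphic.Brandt.XiSetup Nplus Nminus) [Fintype (Literature.NumberTheory.Automorphic.Brandt.ClassSet S.O)], Nat.card {x : Literature.NumberTheory.Automorphic.Brandt.ClassSet S.O → ZMod 2 // ∀ p : ℕ, p.Prime → ¬ p ∣ Nplus * Nminus → Matrix.mulVec ((Literature.NumberTheory.Automorphic.Brandt.matrix S.O p).map (Int.castRingHom (ZMod 2))) x = ((W.LFunction p : ℤ) : ZMod 2) • x} = 2) → ∀ (D : Literature.NumberTheory.EllipticCurves.ModularForms.ModularParametrizationData W (W.conductorNorm ℤ)) (W₀ : WeierstrassCurve ℚ) [W₀.IsElliptic] (D₀ : Literature.NumberTheory.EllipticCurves.ModularForms.ModularParametrizationData W₀ (W.conductorNorm ℤ)), D₀.f = D.f → (∀ (W' : WeierstrassCurve ℚ) [W'.IsElliptic] (D' : Literature.NumberTheory.EllipticCurves.ModularForms.ModularParametrizationData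 W' (W.conductorNorm ℤ)), D'.f = D₀.f → D₀.modularDegree ≤ D'.modularDegree) → (D₀.modularDegree.factorization 2 : ℤ) = ((Literature.NumberTheory.Automorphic.brandtXi Nplus Nminus (fun n => W.LFunction n)).factorization 2 : ℤ) + ∑ q ∈ Nminus.primeFactors, (((W.minimalDiscriminantNorm ℤ).factorization q).factorization 2 : ℤ)

-- parent: GrossPeriodAnalyticShaAtTwo · child (gen 1)
/--     item stmt-BirchSwinnertonDyer-24588 · crux · rank 303 · open
    parent: GrossPeriodAnalyticShaAtTwo · by planner
    why it might fail: The 2-power bookkeeping between (f,f), deg φ, Ω(E/K) (tree bsdPeriod, Dokchitser 2010) and Gross's ξ-normalised period is nowhere printed at p = 2: CST's constant has local factors at 2 and at q | N⁻; u_K, c_Manin, #E(K)[2] must be tracked; a uniform offset 2^k ≠ 1 falsifies it as typed.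
    sources: arXiv:1408.1733, Gross1987, doi:10.4007/annals.2006.163.901, arXiv:1604.02165, BertoliniLongoVenerucci2026
[K3 · rank 4 of the split] EXPLICIT GROSS/WALDSPURGER VALUE AT 2: on the C2 habitat (K imaginary
quadratic with (d_K, 2N) = 1, N⁺-split/N⁻-inert, Gross point data, Gross period GP ≠ 0) with odd
unit weights, for the optimal W₀ sharing W's newform: analyticSha(W/K) is a rational q with ord₂ q =
2·ord₂ GP + ord₂ deg φ_{W₀} − ord₂ ξ − Σ_{q|N⁻} ord₂(ord_q Δ_min). This is the 2-adic valuation of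
the explicit Gross formula L(E/K,1) = (f,f)/(u_K² √|d_K|) · GP²/ξ-normalisation (Gross 1987;
Cai–Shu–Tian 2014 Thm 1.5/1.10) combined with deg φ · Ω_E Ω_{E^K}-type period relation ((f,f) ↔ deg
φ · vol, Manin constant a 2-unit on the semistable habitat by Česnavičius), written so that the only
non-explicit 2-power is the one K2 supplies. -/
@[route_item "route-BirchSwinnertonDyer-DefiniteGrossPeriodAtTwo"]
def ExplicitGrossValueAtTwo : Prop :=
  ∀ (W : WeierstrassCurve ℚ) [W.IsElliptic] [W.IsGloballyMinimal] [NeZero (W.conductorNorm ℤ)] (Nplus Nminus : ℕ) (a b : ℚ) (O : Subring (QuaternionAlgebra ℚ a 0 b)) (K : Type) [Field K] [NumberField K] (ψ : K →ₐ[ℚ] QuaternionAlgebra ℚ a 0 b) (I : Submodule ℤ (QuaternionAlgebra ℚ a 0 b)) (φ : Submodule ℤ (QuaternionAlgebra ℚ a 0 b) → ℤ) (rep : ClassGroup (NumberField.RingOfIntegers K) → nonZeroDivisors (Ideal (NumberField.RingOfIntegers K))) (RI : Set (Submodule ℤ (QuaternionAlgebra ℚ a 0 b))) (IsEig : (Submodule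 ℤ (QuaternionAlgebra ℚ a 0 b) → ℤ) → Prop), ¬ W.HasCM → (W.HasSurjectiveModNGaloisRep (2 : ℤ) ∧ ¬ IsSquare (-(W.Δ)) ∧ Squarefree (W.conductorNorm ℤ) ∧ (∀ q ∈ (W.conductorNorm ℤ).primeFactors, Odd ((W.minimalDiscriminantNorm ℤ).factorization q)) ∧ (¬ 2 ∣ W.conductorNorm ℤ → ∃ v : IsDedekindDomain.HeightOneSpectrum (NumberField.RingOfIntegers ℚ), ((2 : ℕ) : NumberField.RingOfIntegers ℚ) ∈ v.asIdeal ∧ ∃ 𝔓 ∈ v.primesAbove, ∃ σ ∈ 𝔓.decompositionSubgroup (Field.absoluteGaloisGroup ℚ), ∃ P : W.geomTorsion (2 : ℤ), σ • P ≠ P)) → (Module.finrank ℚ K = 2 ∧ NumberField.IsTotallyComplex K ∧ Int.gcd (NumberField.discr K) (W.conductorNorm ℤ * 2) = 1 ∧ W.conductorNorm ℤ = Nplus * Nminus ∧ Nat.Coprime Nplus Nminus ∧ ¬ 2 ∣ Nminus ∧ Odd Nminus.primeFactors.card ∧ (∀ q : ℕ, q.Prime → q ∣ Nplus → ((Ideal.span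 {(q : ℤ)}).primesOver (NumberField.RingOfIntegers K)).ncard = 2) ∧ (∀ q : ℕ, q.Prime → q ∣ Nminus → ((Ideal.span {(q : ℤ)}).primesOver (NumberField.RingOfIntegers K)).ncard = 1)) → Literature.NumberTheory.EllipticCurves.BertoliniLongoVenerucci2026.GrossPointData W Nplus Nminus a b O K ψ I φ rep RI IsEig → Literature.NumberTheory.EllipticCurves.BertoliniLongoVenerucci2026.grossPeriod K ψ I φ rep ≠ 0 → (∀ S : Literature.NumberTheory.Automorphic.Brandt.XiSetup Nplus Nminus, ∀ c : Literature.NumberTheory.Automorphic.Brandt.ClassSet S.O, Odd (Literature.NumberTheory.Automorphic.Brandt.weight S.O c)) → ∀ (D : Literature.NumberTheory.EllipticCurves.ModularForms.ModularParametrizationData W (W.conductorNorm ℤ)) (W₀ : WeierstrassCurve ℚ) [W₀.IsElliptic] (D₀ : Literature.NumberTheory.EllipticCurves.ModularForms.ModularParametrizationData W₀ (W.conductorNorm ℤ)), D₀.f = D.f → (∀ (W' : WeierstrassCurve ℚ) [W'.IsElliptic] (D' : Literature.NumberTheory.EllipticCurves.ModularForms.ModularParametrizationData W' (W.conductorNorm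 ℤ)), D'.f = D₀.f → D₀.modularDegree ≤ D'.modularDegree) → ∃ q : ℚ, Literature.NumberTheory.EllipticCurves.analyticSha (W.baseChange K) = (q : ℂ) ∧ padicValRat 2 q = 2 * padicValInt 2 (Literature.NumberTheory.EllipticCurves.BertoliniLongoVenerucci2026.grossPeriod K ψ I φ rep) + (D₀.modularDegree.factorization 2 : ℤ) - ((Literature.NumberTheory.Automorphic.brandtXi Nplus Nminus (fun n => W.LFunction n)).factorization 2 : ℤ) - ∑ q ∈ Nminus.primeFactors, (((W.minimalDiscriminantNorm ℤ).factorization q).factorization 2 : ℤ)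

-- parent: GrossPeriodAnalyticShaAtTwo · child (gen 1)
/--     item stmt-BirchSwinnertonDyer-24589 · crux · rank 305 · open
    parent: GrossPeriodAnalyticShaAtTwo · by planner
    why it might fail: It is the parent crux C2 on the even-weight regime — residual, summit-strength relative to C2 there; the bet is only that the odd-weight regime (all w_i ∈ {1,3}) is where H3-habitat curves of interest live (N⁻ with a prime ≡ 1 mod 12 forces all w_i = 1).
    sources: doi:10.1090/S0894-0347-02-00390-7, Gross1987, BertoliniLongoVenerucci2026
[R · declared RESIDUAL of the split · not attacked by this line] The parent crux
GrossPeriodAnalyticShaAtTwo restricted to the complementary regime where some Eichler-order class of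
level N⁺ in the definite algebra of discriminant N⁻ has an EVEN unit weight w_i = #O_iˣ/2 (extra
automorphisms by ℤ[i] or ℤ[ζ₃]; by Eichler's embedding-number formula this is the regime where no q
| N⁻ is ≡ 1 mod 4, resp. mod 3, obstructs). On this regime the mod-2 Brandt module has
Eisenstein-at-2 degeneracies (Emerton 2002) and the line's mult-one lever does not apply as typed;
it is carried as the honest complement so that the glue K1 → K2 → K3 → S → R → C2 is total. -/
@[route_item "route-BirchSwinnertonDyer-DefiniteGrossPeriodAtTwo"]
def EvenWeightResidualAtTwo : Prop :=
  ∀ (W : WeierstrassCurve ℚ) [W.IsElliptic] [W.IsGloballyMinimal] [NeZero (W.conductorNorm ℤ)] (Nplus Nminus : ℕ) (a b : ℚ) (O : Subring (QuaternionAlgebra ℚ a 0 b)) (K : Type) [Field K] [NumberField K] (ψ : K →ₐ[ℚ] QuaternionAlgebra ℚ a 0 b) (I : Submodule ℤ (QuaternionAlgebra ℚ a 0 b)) (φ : Submodule ℤ (QuaternionAlgebra ℚ a 0 b) → ℤ) (rep : ClassGroup (NumberField.RingOfIntegers K) → nonZeroDivisors (Ideal (NumberField.RingOfIntegers K))) (RI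 : Set (Submodule ℤ (QuaternionAlgebra ℚ a 0 b))) (IsEig : (Submodule ℤ (QuaternionAlgebra ℚ a 0 b) → ℤ) → Prop), ¬ W.HasCM → (W.HasSurjectiveModNGaloisRep (2 : ℤ) ∧ ¬ IsSquare (-(W.Δ)) ∧ Squarefree (W.conductorNorm ℤ) ∧ (∀ q ∈ (W.conductorNorm ℤ).primeFactors, Odd ((W.minimalDiscriminantNorm ℤ).factorization q)) ∧ (¬ 2 ∣ W.conductorNorm ℤ → ∃ v : IsDedekindDomain.HeightOneSpectrum (NumberField.RingOfIntegers ℚ), ((2 : ℕ) : NumberField.RingOfIntegers ℚ) ∈ v.asIdeal ∧ ∃ 𝔓 ∈ v.primesAbove, ∃ σ ∈ 𝔓.decompositionSubgroup (Field.absoluteGaloisGroup ℚ), ∃ P : W.geomTorsion (2 : ℤ), σ • P ≠ P)) → (Module.finrank ℚ K = 2 ∧ NumberField.IsTotallyComplex K ∧ Int.gcd (NumberField.discr K) (W.conductorNorm ℤ * 2) = 1 ∧ W.conductorNorm ℤ = Nplus * Nminus ∧ Nat.Coprime Nplus Nminus ∧ ¬ 2 ∣ Nminus ∧ Odd Nminus.primeFactors.card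 ∧ (∀ q : ℕ, q.Prime → q ∣ Nplus → ((Ideal.span {(q : ℤ)}).primesOver (NumberField.RingOfIntegers K)).ncard = 2) ∧ (∀ q : ℕ, q.Prime → q ∣ Nminus → ((Ideal.span {(q : ℤ)}).primesOver (NumberField.RingOfIntegers K)).ncard = 1)) → Literature.NumberTheory.EllipticCurves.BertoliniLongoVenerucci2026.GrossPointData W Nplus Nminus a b O K ψ I φ rep RI IsEig → Literature.NumberTheory.EllipticCurves.BertoliniLongoVenerucci2026.grossPeriod K ψ I φ rep ≠ 0 → ¬ (∀ S : Literature.NumberTheory.Automorphic.Brandt.XiSetup Nplus Nminus, ∀ c : Literature.NumberTheory.Automorphic.Brandt.ClassSet S.O, Odd (Literature.NumberTheory.Automorphic.Brandt.weight S.O c)) → ∃ q : ℚ, Literature.NumberTheory.EllipticCurves.analyticSha (W.baseChange K) = (q : ℂ) ∧ padicValRat 2 q = 2 * padicValInt 2 (Literature.NumberTheory.EllipticCurves.BertoliniLongoVenerucci2026.grossPeriod K ψ I φ rep)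

-- parent: GrossPeriodAnalyticShaAtTwo · child (gen 1)
/--     item stmt-BirchSwinnertonDyer-19266 · support · rank 304 · open
    parent: GrossPeriodAnalyticShaAtTwo · by planner
    sources: doi:10.1090/S0894-0347-01-00370-8
[support] modularity of E/ℚ as parametrisation data (Breuil–Conrad–Diamond–Taylor 2001 Thm A), BY
NAME — conjunct of OrdPublishedInputsAtTwo (19149; Literature.Uncategorized.OrdPublishedInputsAtTwo
l.26); same content, filed so the head constant is item-stated (#15c one rule; cite_only dep) -/
@[route_item "route-BirchSwinnertonDyer-DefiniteGrossPeriodAtTwo"]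
def ModularitySupply : Prop :=
  Literature.NumberTheory.EllipticCurves.ModularForms.nonempty_modularParametrizationData

-- parent: GrossPeriodAnalyticShaAtTwo · glue (gen 1)
/--     item stmt-BirchSwinnertonDyer-24590 · support · rank 306 · open
    parent: GrossPeriodAnalyticShaAtTwo · GLUE: children ⟹ parent · by planner
LINE 5 (bsd-idea-1 g3, PatchedGrossFormulaAtTwo): DefiniteMultiplicityOneAtTwo → RibetTakahashiAtTwo
→ ExplicitGrossValueAtTwo → ModularitySupply → EvenWeightResidualAtTwo →
GrossPeriodAnalyticShaAtTwo. Proof = case split on odd unit weights; optimal curve W₀ by Nat.find on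
the modular degree (ModularitySupply); substitute K2's 2-adic degree identity into K3's valuation
and ; even weights = the declared residual. Kernel-checked proof attached as evidence
(mock_render5.lean rc 0, 0 sorry). No summit is proved by this line. -/
@[route_item "route-BirchSwinnertonDyer-DefiniteGrossPeriodAtTwo"]
def GrossPeriodAnalyticShaAtTwoOfSplit : Prop :=
  DefiniteMultiplicityOneAtTwo → RibetTakahashiAtTwo → ExplicitGrossValueAtTwo → ModularitySupply → EvenWeightResidualAtTwo → GrossPeriodAnalyticShaAtTwo

/-- item stmt-BirchSwinnertonDyer-23666 · crux · rank 4 · SPLIT (gen 2) into MultKatoBoundAtTwoBigImage, OrdKatoBoundAtTwoBigImage, SupersingularKatoBoundAtTwoBigImage, AdditiveKatoBoundAtTwoBigImage + glue KatoBoundAtTwoOfBigImageCells · direct attempts still welcome (low priority) · by planner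
why it might fail: Kato2004 Thm 17.4 / Rubin2000 Thm 2.2.2 assume p ≠ 2: at 2 the Chebotarev choice of Kolyvagin primes, the Cassels–Tate/Flach pairing sign and the local condition at 2 (2-adic Coleman map when 2 | N multiplicative) need re-proof; f1-sign2 K2 probes saw 2-power anomalies.
sources: Kato2004, Rubin2000, MazurRubin2004, arXiv:2203.12157, arXiv:1709.05780
earlier split gen 1: MultUpperHalfAtTwo, OrdUpperHalfAtTwo, SupersingularUpperHalfAtTwo, AdditiveUpperHalfAtTwo, RankFinitenessInput — retired stmt-BirchSwinnertonDyer-19921, stmt-BirchSwinnertonDyer-19922, stmt-BirchSwinnertonDyer-27845, stmt-BirchSwinnertonDyer-27846, stmt-BirchSwinnertonDyer-27847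
retired/moot children: MultUpperHalfAtTwo [retired: ∀ (W : WeierstrassCurve ℚ) [W.IsElliptic] [W.IsGloballyMinimal], ¬ W.HasCM → W.a]; OrdUpperHalfAtTwo [retired: ∀ (W : WeierstrassCurve ℚ) [W.IsElliptic] [W.IsGloballyMinimal], ¬ W.HasCM → W.a]; SupersingularUpperHalfAtTwo [retired: ∀ (W : WeierstrassCurve ℚ) [W.IsElliptic] [W.IsGloballyMinimal], ¬ W.HasCM → W.a]; AdditiveUpperHalfAtTwo [retired: ∀ (W : WeierstrassCurve ℚ) [W.IsElliptic] [W.IsGloballyMinimal], ¬ W.HasCM → W.a]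
[crux] [C3, card K3] For non-CM E/ℚ on H₃ with analytic rank 0: Ш(E/ℚ)[2^∞] is finite and ord₂
#Ш(E/ℚ)[2^∞] ≤ ord₂ #Ш_an(E/ℚ) (`shaAn`), and the same for every globally minimal model of a
quadratic twist E^d with (d, 2N) = 1 of analytic rank 0 (twist-stable one-sided divisibility at 2:
Kato's Euler system + Kolyvagin-system bound at p = 2 under surjective ρ̄_(E,2) and a multiplicative
prime supplying τ). [difficulty: L] -/
@[route_item "route-BirchSwinnertonDyer-DefiniteGrossPeriodAtTwo", crux]
def KatoBoundAtTwo : Prop :=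
  ∀ (W : WeierstrassCurve ℚ) [W.IsElliptic] [W.IsGloballyMinimal], ¬ W.HasCM → (W.HasSurjectiveModNGaloisRep (2 : ℤ) ∧ ¬ IsSquare (-(W.Δ)) ∧ Squarefree (W.conductorNorm ℤ) ∧ (∀ q ∈ (W.conductorNorm ℤ).primeFactors, Odd ((W.minimalDiscriminantNorm ℤ).factorization q)) ∧ (¬ 2 ∣ W.conductorNorm ℤ → ∃ v : IsDedekindDomain.HeightOneSpectrum (NumberField.RingOfIntegers ℚ), ((2 : ℕ) : NumberField.RingOfIntegers ℚ) ∈ v.asIdeal ∧ ∃ 𝔓 ∈ v.primesAbove, ∃ σ ∈ 𝔓.decompositionSubgroup (Field.absoluteGaloisGroup ℚ), ∃ P : W.geomTorsion (2 : ℤ), σ • P ≠ P)) → W.analyticRank = 0 → (Finite (AddCommGroup.primaryComponent W.sha 2) ∧ ∃ q : ℚ, Literature.NumberTheory.EllipticCurves.shaAn W = (q : ℂ) ∧ ((padicValNat 2 (Nat.card (AddCommGroup.primaryComponent W.sha 2)) : ℤ) ≤ padicValRat 2 q)) ∧ ∀ (d : ℤ), Int.gcd d (W.conductorNorm ℤ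 * 2) = 1 → ∀ (Wd : WeierstrassCurve ℚ) [Wd.IsElliptic] [Wd.IsGloballyMinimal], (∃ C : WeierstrassCurve.VariableChange ℚ, C • W.quadraticTwist (d : ℚ) = Wd) → Wd.analyticRank = 0 → (Finite (AddCommGroup.primaryComponent Wd.sha 2) ∧ ∃ q : ℚ, Literature.NumberTheory.EllipticCurves.shaAn Wd = (q : ℂ) ∧ ((padicValNat 2 (Nat.card (AddCommGroup.primaryComponent Wd.sha 2)) : ℤ) ≤ padicValRat 2 q))

-- parent: KatoBoundAtTwo · child (gen 1)
-- TODO     item stmt-BirchSwinnertonDyer-27848 · support · rank 406 · closed · proved by Summit.BirchSwinnertonDyer.BirchSwinnertonDyer.Theorems.DefiniteGrossGlue.katoBoundAtTwoOfUpperHalves_proof (planner) — BLOCKED: missing decl(s) RankFinitenessInput; restate via `ledger route edit` once they land: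
--   def KatoBoundAtTwoOfUpperHalves : Prop := MultUpperHalfAtTwo → OrdUpperHalfAtTwo → SupersingularUpperHalfAtTwo → AdditiveUpperHalfAtTwo → RankFinitenessInput → KatoBoundAtTwo

-- parent: KatoBoundAtTwo · child (gen 2)
/--     item stmt-BirchSwinnertonDyer-22966 · crux · rank 401 · open
    parent: KatoBoundAtTwo · by planner
    why it might fail: Kato Thm 17.4(3) control and the unit 𝓛-invariant/Tamagawa factor at a MULTIPLICATIVE p are printed for p odd only (Skinner–Urban §3.6, Skinner mult. red.); at a split-multiplicative 2 the trivial zero costs a power of 2 nobody has bounded.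
    sources: Kato2004Asterisque, SkinnerUrban2014, GreenbergLNM1716, Miller2011LMS, GrossZagier1986, Kolyvagin1990
[crux] (LINE 12′, pen bsd-idea-1 g8; ONE READER: follows from ByReductionTypeAtTwo 19922
`MultUpperHalfAtTwo` + 19921 GZK by the registered 2-stub skeleton
Cruxes/MultKatoBoundAtTwoBigImage/Lines/birth.lean, composition proved) `KatoBoundAtTwo` on the cell
«non-CM, ρ̄_{E,2} SURJECTIVE, −Δ non-square, analytic rank 0, MULTIPLICATIVE at 2», in the PARENT's
currency «Finite Ш(E)[2^∞] ∧ ord₂ #Ш(E)[2^∞] ≤ ord₂ Ш_an(E)» (GZK finiteness enters through the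
cell's skeleton stub, not the glue): Kato's divisibility at a multiplicative 2 read through
Greenberg-type control (non-split: ordinary type; split: trivial zero). -/
@[route_item "route-BirchSwinnertonDyer-DefiniteGrossPeriodAtTwo"]
def MultKatoBoundAtTwoBigImage : Prop :=
  ∀ (W : WeierstrassCurve ℚ) [W.IsElliptic] [W.IsGloballyMinimal], ¬ W.HasCM → W.HasSurjectiveModNGaloisRep (2 : ℤ) → ¬ IsSquare (-(W.Δ)) → W.analyticRank = 0 → Literature.NumberTheory.EllipticCurves.Rank1Residual.Mult W 2 → (Finite (AddCommGroup.primaryComponent W.sha 2) ∧ ∃ q : ℚ, Literature.NumberTheory.EllipticCurves.shaAn W = (q : ℂ) ∧ ((padicValNat 2 (Nat.card (AddCommGroup.primaryComponent W.sha 2)) : ℤ) ≤ padicValRat 2 q))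

-- parent: KatoBoundAtTwo · child (gen 2)
/--     item stmt-BirchSwinnertonDyer-22971 · crux · rank 402 · open
    parent: KatoBoundAtTwo · by planner
    why it might fail: Even with ρ̄₂ surjective (no rational 2-torsion), Kato Thm 17.4(3)'s integral divisibility at p = 2 is not in print (his image hypothesis is stated for p odd / SL₂(ℤ_p)-image); 'at some isogenous member' may still be off by a power of 2 (integrality of L₂ at 2).
    sources: Kato2004Asterisque, GreenbergLNM1716, Miller2011LMS, MilneADT2006
[crux] (LINE 12′ = idea-crit-5 V100 price 1 / director-bsd (217)(g): the LINE-12 child re-typed with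
the twist-invariant H₃ clauses «HasSurjectiveModNGaloisRep 2 ∧ ¬IsSquare(−Δ)»; KEY child; birth
skeleton Cruxes/OrdKatoBoundAtTwoBigImage/Lines/birth.lean: stub 1 = ByReductionTypeAtTwo 19573
restricted to surjective ρ̄₂ (Kato's ϖ·L₂ ∈ char_Λ X at some isogenous member), stubs 2–3 = 19149 /
19567 verbatim (PRINT), composition proved via the X5 door + Cassels transport + GZK currency
conversion) `KatoBoundAtTwo` on the cell «non-CM, ρ̄_{E,2} SURJECTIVE, −Δ non-square, analytic rank
0, GOOD ORDINARY at 2», in the PARENT's currency «Finite Ш(E)[2^∞] ∧ ord₂ #Ш(E)[2^∞] ≤ ord₂ Ш_an(E)»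
(GZK finiteness enters through the cell's skeleton stub, not the glue). -/
@[route_item "route-BirchSwinnertonDyer-DefiniteGrossPeriodAtTwo"]
def OrdKatoBoundAtTwoBigImage : Prop :=
  ∀ (W : WeierstrassCurve ℚ) [W.IsElliptic] [W.IsGloballyMinimal], ¬ W.HasCM → W.HasSurjectiveModNGaloisRep (2 : ℤ) → ¬ IsSquare (-(W.Δ)) → W.analyticRank = 0 → Literature.NumberTheory.EllipticCurves.Rank1Residual.GoodOrd W 2 → (Finite (AddCommGroup.primaryComponent W.sha 2) ∧ ∃ q : ℚ, Literature.NumberTheory.EllipticCurves.shaAn W = (q : ℂ) ∧ ((padicValNat 2 (Nat.card (AddCommGroup.primaryComponent W.sha 2)) : ℤ) ≤ padicValRat 2 q))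

-- parent: KatoBoundAtTwo · child (gen 2)
/--     item stmt-BirchSwinnertonDyer-22972 · crux · rank 403 · open
    parent: KatoBoundAtTwo · by planner
    why it might fail: No ±/♯♭ signed Iwasawa theory in print at p = 2 (Kobayashi/Sprung need p odd; a₂ ∈ {0, ±2}); surjective ρ̄₂ removes the Eisenstein cases but not the missing signed control theorem at 2.
    sources: Kobayashi2003, Sprung2012, Wan2020, CastellaCiperianiSkinnerSprung2018
[crux] (LINE 12′ = V100 price 1: re-typed with the twist-invariant H₃ clauses) `KatoBoundAtTwo` on
the cell «non-CM, ρ̄_{E,2} SURJECTIVE, −Δ non-square, analytic rank 0, GOOD SUPERSINGULAR at 2» (a₂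
even), in the PARENT's currency «Finite Ш(E)[2^∞] ∧ ord₂ #Ш(E)[2^∞] ≤ ord₂ Ш_an(E)» (GZK finiteness
enters through the cell's skeleton stub, not the glue) — the signed (±/♯♭) Kato–Kobayashi
divisibility + signed control at p = 2. -/
@[route_item "route-BirchSwinnertonDyer-DefiniteGrossPeriodAtTwo"]
def SupersingularKatoBoundAtTwoBigImage : Prop :=
  ∀ (W : WeierstrassCurve ℚ) [W.IsElliptic] [W.IsGloballyMinimal], ¬ W.HasCM → W.HasSurjectiveModNGaloisRep (2 : ℤ) → ¬ IsSquare (-(W.Δ)) → W.analyticRank = 0 → Literature.NumberTheory.EllipticCurves.Rank1Residual.GoodSS W 2 → (Finite (AddCommGroup.primaryComponent W.sha 2) ∧ ∃ q : ℚ, Literature.NumberTheory.EllipticCurves.shaAn W = (q : ℂ) ∧ ((padicValNat 2 (Nat.card (AddCommGroup.primaryComponent W.sha 2)) : ℤ) ≤ padicValRat 2 q))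

-- parent: KatoBoundAtTwo · child (gen 2)
/--     item stmt-BirchSwinnertonDyer-22973 · crux · rank 404 · open
    parent: KatoBoundAtTwo · by planner
    why it might fail: Additive reduction at 2 has no Selmer-condition / 2-adic L-function in print (Delbourgo only for p ≥ 3 potentially good); 781/1945 f1 classes are wild at 2; big image does not help with the local condition.
    sources: Delbourgo1998, Matsuno2008, GreenbergVatsal2000, Kato2004Asterisque
[crux] (LINE 12′ = V100 price 1: re-typed with the twist-invariant H₃ clauses; consumption audit
V100 price 2: the parent's twist clause only reaches this cell for d ≡ 3 mod 4 twists of a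
good/mult-at-2 curve or an additive-at-2 W itself) `KatoBoundAtTwo` on the cell «non-CM, ρ̄_{E,2}
SURJECTIVE, −Δ non-square, analytic rank 0, ADDITIVE at 2», in the PARENT's currency «Finite
Ш(E)[2^∞] ∧ ord₂ #Ш(E)[2^∞] ≤ ord₂ Ш_an(E)» (GZK finiteness enters through the cell's skeleton stub,
not the glue) — reachable only by twist-transport from a semistable quadratic twist (Matsuno 2008
Thm 5.1 road) or a genuinely new additive-at-2 Selmer condition. -/
@[route_item "route-BirchSwinnertonDyer-DefiniteGrossPeriodAtTwo"]
def AdditiveKatoBoundAtTwoBigImage : Prop :=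
  ∀ (W : WeierstrassCurve ℚ) [W.IsElliptic] [W.IsGloballyMinimal], ¬ W.HasCM → W.HasSurjectiveModNGaloisRep (2 : ℤ) → ¬ IsSquare (-(W.Δ)) → W.analyticRank = 0 → Literature.NumberTheory.EllipticCurves.Rank1Residual.Addv W 2 → (Finite (AddCommGroup.primaryComponent W.sha 2) ∧ ∃ q : ℚ, Literature.NumberTheory.EllipticCurves.shaAn W = (q : ℂ) ∧ ((padicValNat 2 (Nat.card (AddCommGroup.primaryComponent W.sha 2)) : ℤ) ≤ padicValRat 2 q))

-- parent: KatoBoundAtTwo · glue (gen 2)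
/--     item stmt-BirchSwinnertonDyer-22974 · support · rank 405 · closed · proved by Summit.BirchSwinnertonDyer.BirchSwinnertonDyer.Theorems.DefiniteGrossGlue.katoBoundAtTwoOfBigImageCells_proof (planner)
    parent: KatoBoundAtTwo · GLUE: children ⟹ parent · by planner
[glue] KatoBoundAtTwo from its four big-image cells (LINE 12′, pen bsd-idea-1 g8 = idea-crit-5 V100
price 1 / director-bsd (217)(g)): case split on the reduction type of W at 2 (good ordinary / good
supersingular / multiplicative / additive) for W itself, and for each admissible twist Wd ≅ W^(d)
after transporting ¬CM (j-invariant; hasCM_iff_j_mem_of_heegnerStarkPrime), surjective ρ̄₂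
(hasSurjectiveModNGaloisRep_two_quadraticTwist_iff + _smul) and «−Δ non-square» (Δ(C•W^(d)) =
u⁻¹²·d⁶·Δ(W), a square factor) to Wd. NO GZK in this glue: each cell is stated in the parent's own
2-primary currency (Finite Ш[2^∞] ∧ ord₂ #Ш[2^∞] ≤ ord₂ Ш_an); GZK finiteness enters the cells'
registered skeleton stubs (ByReductionTypeAtTwo 19149 / 19921 by name). Kernel-certified: pen folder
line12c/Sketch12c.lean `katoBoundAtTwoOfBigImageCells_proof` (farm rc 0, 0 sorry); lands as
Theorems/DefiniteGrossPeriodAtTwoKatoBoundOfBigImageCellsGlue.lean. -/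
@[route_item "route-BirchSwinnertonDyer-DefiniteGrossPeriodAtTwo"]
def KatoBoundAtTwoOfBigImageCells : Prop :=
  MultKatoBoundAtTwoBigImage → OrdKatoBoundAtTwoBigImage → SupersingularKatoBoundAtTwoBigImage → AdditiveKatoBoundAtTwoBigImage → KatoBoundAtTwo

-- `KatoBoundAtTwoOfBigImageCells` holds: proved by `Summit.BirchSwinnertonDyer.BirchSwinnertonDyer.Theorems.DefiniteGrossGlue.katoBoundAtTwoOfBigImageCells_proof` (its module imports this route file, so no `_holds` link can be stated here).

/-- item stmt-BirchSwinnertonDyer-23667 · crux · rank 5 · SPLIT (gen 1) into AnchorPrimitivityAtTwo, KolyvaginExactAtTwoShifted, MirrorExactDescentAtTwo, DefiniteAnchorBSDTwo, OffAnchoredTwistResidualAtTwo + glue OffDefiniteHabitatAtTwoOfAnchor · direct attempts still welcome (low priority) · by planner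
why it might fail: It is an open problem containing most of the leaf (all rank-1 cells, all 4 | N cells); declared residual so the tribunal reads the line as H₃-conditional progress on K4, not as a claim on it.
sources: arXiv:1010.2431, Kolyvagin1989, GrossZagier1986, arXiv:1501.01344
[crux] [R, residual — declared complement, not attacked by this line] BSD_2 for non-CM E/ℚ of
analytic rank ≤ 1 OFF the definite habitat: analytic rank 1, or ρ̄_(E,2) not surjective, or ℚ(E[2])
⊇ ℚ(i), or N not squarefree, or some v_q(Δ_min) even, or (2 ∤ N and E[2] unramified-trivial at 2).
This is the part of the leaf the line does NOT reduce; it is served to nobody by this route and is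
listed so that `closes` is honest. [difficulty: open-problem] -/
@[route_item "route-BirchSwinnertonDyer-DefiniteGrossPeriodAtTwo", crux]
def OffDefiniteHabitatAtTwo : Prop :=
  ∀ (W : WeierstrassCurve ℚ) [W.IsElliptic] [W.IsGloballyMinimal], ¬ W.HasCM → W.analyticRank ≤ 1 → ¬ (W.analyticRank = 0 ∧ (W.HasSurjectiveModNGaloisRep (2 : ℤ) ∧ ¬ IsSquare (-(W.Δ)) ∧ Squarefree (W.conductorNorm ℤ) ∧ (∀ q ∈ (W.conductorNorm ℤ).primeFactors, Odd ((W.minimalDiscriminantNorm ℤ).factorization q)) ∧ (¬ 2 ∣ W.conductorNorm ℤ → ∃ v : IsDedekindDomain.HeightOneSpectrum (NumberField.RingOfIntegers ℚ), ((2 : ℕ) : NumberField.RingOfIntegers ℚ) ∈ v.asIdeal ∧ ∃ 𝔓 ∈ v.primesAbove, ∃ σ ∈ 𝔓.decompositionSubgroup (Field.absoluteGaloisGroup ℚ), ∃ P : W.geomTorsion (2 : ℤ), σ • P ≠ P))) → Literature.NumberTheory.EllipticCurves.BSDp W 2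

-- parent: OffDefiniteHabitatAtTwo · child (gen 1)
/--     item stmt-BirchSwinnertonDyer-27576 · crux · rank 501 · open
    parent: OffDefiniteHabitatAtTwo · by planner
    why it might fail: Kolyvagin's conjecture is open at p=2 even in rank 0 (Zhang 2014 needs p≥5: no level-raising admissible primes at 2; BCGS need p≥3); without Selmer-minimality Ш(B^d)[2]≠0 occurs and extra 2-divisibility of genus traces is forced on Δ>0 cells (U-LEDGER R1′) — excluded by Δ<0, untested at depth ≥2.
    sources: Kolyvagin1991MathAnn, WZhang2014, arXiv:2312.09301, GrossLMS1991, McCallumLMS1991, arXiv:1609.06687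
[crux · LINE 11 KEY · A1] ANCHOR PRIMITIVITY AT 2 (Kolyvagin's conjecture at 2 in the strong form
𝓜_∞ = 0, on the definite-anchor frame): for a non-CM analytic-rank-0 B with Δ<0, odd conductor,
surjective 2-adic tower, odd Tamagawa product and an optimal odd-Manin frame, for EVERY admissible
Heegner field K (odd d_K ≠ −3, Heegner, the two non-square side conditions) with y_K of infinite
order whose twist B^{(d_K)} has analytic rank 1: the exact 2-divisibility exponent M₀ of y_K exists
and some Kolyvagin derivative class P_n (n square-free of Kolyvagin primes at 2, all M(ℓ) ≥ 1) is
NOT 2-divisible in B(K[n]). This is GK2's U/P kernel family (24947/22136) WITHOUT the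
Selmer-minimal-twin binder (#Sel₂(B^{(d)}) = 2 is not needed because descent runs the other way) —
bank with U: one mechanism (multi-genus traces + Gross–Zagier at a_ℓ-even primes), registered birth
skeleton stub_multiGenusTraceAllTwins + stub_genusTraceToDerivativeCertificate. BSD-consistency:
with odd c, odd Manin and u_K = 1, BSD(B/K) predicts #Ш(B/K)[2^∞] = 2^{2M₀}, i.e. 𝓜_∞ = 0. Role in
the line: feeds KolyvaginExactAtTwoShifted at t = 0 for the rank-0 ANCHOR — the Kolyvagin
computation is moved to the twist-minimal -/
@[route_item "route-BirchSwinnertonDyer-DefiniteGrossPeriodAtTwo"]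
def AnchorPrimitivityAtTwo : Prop :=
  ∀ (W : WeierstrassCurve ℚ) [W.IsElliptic] [W.IsGloballyMinimal] [NeZero (W.conductorNorm ℤ)], ¬ W.HasCM → W.analyticRank = 0 → W.Δ < 0 → ¬ 2 ∣ W.conductorNorm ℤ → (∀ n : ℕ, 0 < n → W.HasSurjectiveModNGaloisRep ((2 : ℤ) ^ n)) → Odd W.tamagawaProduct → ∀ (K : Type) [Field K] [NumberField K], Literature.NumberTheory.EllipticCurves.IsImaginaryQuadratic K → Odd (NumberField.discr K) → NumberField.discr K ≠ -3 → Literature.NumberTheory.EllipticCurves.SatisfiesHeegnerHypothesis (W.conductorNorm ℤ) K → ¬ IsSquare ((NumberField.discr K : ℚ) * -|W.Δ|) → ¬ IsSquare ((NumberField.discr K : ℚ) * (-(2 * |W.Δ|))) → ∀ (Dt : Literature.NumberTheory.EllipticCurves.ModularForms.ModularParametrizationData W (W.conductorNorm ℤ)), (∀ z ∈ Dt.L.lattice, ∃ w ∈ Literature.NumberTheory.EllipticCurves.ModularForms.periodLattice Dt.f, z = (Dt.c : ℂ) * w) → Odd Dt.c → ∀ (β : ℤ) (ι : K →+* ℂ)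 (d₁ : Literature.NumberTheory.EllipticCurves.KolyvaginHeegnerData Dt β ι 1), ¬ IsOfFinAddOrder d₁.derivedPoint → ∀ (Wd : WeierstrassCurve ℚ) [Wd.IsElliptic] [Wd.IsGloballyMinimal], (∃ C : WeierstrassCurve.VariableChange ℚ, C • W.quadraticTwist (NumberField.discr K : ℚ) = Wd) → Wd.analyticRank = 1 → (∃ M₀ : ℕ, (∃ Q : (W.baseChange (Literature.NumberTheory.EllipticCurves.ringClassField K ι 1)).toAffine.Point, ((2 ^ M₀ : ℕ) : ℤ) • Q = d₁.derivedPoint) ∧ ¬ (∃ Q : (W.baseChange (Literature.NumberTheory.EllipticCurves.ringClassField K ι 1)).toAffine.Point, ((2 ^ (M₀ + 1) : ℕ) : ℤ) • Q = d₁.derivedPoint)) ∧ ∃ (n : ℕ) (d : Literature.NumberTheory.EllipticCurves.KolyvaginHeegnerData Dt β ι n), Squarefree n ∧ (∀ ℓ ∈ n.primeFactors, Literature.NumberTheory.EllipticCurves.Zhang2014.IsKolyvaginPrime (W.conductorNorm ℤ) W K 2 ℓ ∧ 1 ≤ Literature.NumberTheory.EllipticCurves.Zhang2014.kolyvaginIndex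 W 2 ℓ) ∧ ¬ ∃ Q : (W.baseChange (Literature.NumberTheory.EllipticCurves.ringClassField K ι n)).toAffine.Point, (2 : ℤ) • Q = d.derivedPoint

-- parent: OffDefiniteHabitatAtTwo · child (gen 1)
/--     item stmt-BirchSwinnertonDyer-27469 · crux · rank 502 · open
    parent: OffDefiniteHabitatAtTwo · by planner
    why it might fail: At p=2 Mazur–Rubin (H.3)/(H.5) fail (H¹(ℚ(E[2^M])/ℚ,E[2^M]) ≠ 0, no eigen-splitting at Kolyvagin primes): the structure theorem may hold only with a bounded error 2^{κ}, not exactly; McCallum's p odd.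
    sources: McCallumLMS1991, KolyvaginEulerSystems1990, MazurRubin2004, Howard2004, doi:10.5802/jtnb.1091
[crux · beyond print at 2] Shifted exactness on Δ < 0: X = KolyvaginExactAtTwo with the Tamagawa
shift t carried — under universal 2^s-divisibility of all derived points on Λ_s for s ≤ t (the
output of TamagawaDivisibilityAtTwo at q₀) and a primitivity certificate at depth t+1, #Ш(E/K)[2^∞]
= 2^{2(M₀ − t)} (McCallum 1991 Thm 5.5/5.8 structure theorem with Kolyvagin's redefined m_∞ = t, run
at p = 2 in the R_M = ℤ/2^M[Gal(K/ℚ)]-equivariant form of LINE 6; at t = 0 this is exactly Q3R's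
target, so the LEAD's Gorenstein/core-rank-one argument is reused with t as a parameter). No summit
is proved by this line. -/
@[route_item "route-BirchSwinnertonDyer-DefiniteGrossPeriodAtTwo"]
def KolyvaginExactAtTwoShifted : Prop :=
  ∀ (W : WeierstrassCurve ℚ) [W.IsElliptic] [W.IsGloballyMinimal] [NeZero (W.conductorNorm ℤ)], ¬ W.HasCM → W.Δ < 0 → ∀ (K : Type) [Field K] [NumberField K], Literature.NumberTheory.EllipticCurves.IsImaginaryQuadratic K → Odd (NumberField.discr K) → NumberField.discr K ≠ -3 → Literature.NumberTheory.EllipticCurves.SatisfiesHeegnerHypothesis (W.conductorNorm ℤ) K → ¬ IsSquare ((NumberField.discr K : ℚ) * -|W.Δ|) → ¬ IsSquare ((NumberField.discr K : ℚ) * (-(2 * |W.Δ|))) → (∀ n : ℕ, 0 < n → W.HasSurjectiveModNGaloisRep ((2 : ℤ) ^ n)) → ∀ (Dt : Literature.NumberTheory.EllipticCurves.ModularForms.ModularParametrizationData W (W.conductorNorm ℤ)) (β : ℤ) (ι : K →+* ℂ) (d₁ : Literature.NumberTheory.EllipticCurves.KolyvaginHeegnerData Dt β ι 1), ¬ IsOfFinAddOrder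 d₁.derivedPoint → ∀ (M₀ : ℕ), (∃ Q : (W.baseChange (Literature.NumberTheory.EllipticCurves.ringClassField K ι 1)).toAffine.Point, ((2 ^ M₀ : ℕ) : ℤ) • Q = d₁.derivedPoint) → (¬ ∃ Q : (W.baseChange (Literature.NumberTheory.EllipticCurves.ringClassField K ι 1)).toAffine.Point, ((2 ^ (M₀ + 1) : ℕ) : ℤ) • Q = d₁.derivedPoint) → ∀ (t : ℕ), (∀ (s : ℕ), s ≤ t → ∀ (n : ℕ) (d : Literature.NumberTheory.EllipticCurves.KolyvaginHeegnerData Dt β ι n), Squarefree n → (∀ ℓ ∈ n.primeFactors, Literature.NumberTheory.EllipticCurves.Zhang2014.IsKolyvaginPrime (W.conductorNorm ℤ) W K 2 ℓ ∧ s ≤ Literature.NumberTheory.EllipticCurves.Zhang2014.kolyvaginIndex W 2 ℓ) → ∃ Q : (W.baseChange (Literature.NumberTheory.EllipticCurves.ringClassField K ι n)).toAffine.Point, ((2 ^ s : ℕ) : ℤ) • Q = d.derivedPoint) → ∀ (n : ℕ) (d : Literature.NumberTheory.EllipticCurves.KolyvaginHeegnerData Dt β ι n), Squarefree n → (∀ ℓ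 ∈ n.primeFactors, Literature.NumberTheory.EllipticCurves.Zhang2014.IsKolyvaginPrime (W.conductorNorm ℤ) W K 2 ℓ ∧ t + 1 ≤ Literature.NumberTheory.EllipticCurves.Zhang2014.kolyvaginIndex W 2 ℓ) → (¬ ∃ Q : (W.baseChange (Literature.NumberTheory.EllipticCurves.ringClassField K ι n)).toAffine.Point, ((2 ^ (t + 1) : ℕ) : ℤ) • Q = d.derivedPoint) → Nat.card (AddCommGroup.primaryComponent (W.baseChange K).sha 2) = 2 ^ (2 * (M₀ - t))

-- parent: OffDefiniteHabitatAtTwo · child (gen 1)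
/--     item stmt-BirchSwinnertonDyer-27579 · crux · rank 505 · open
    parent: OffDefiniteHabitatAtTwo · by planner
    why it might fail: It is the rest of W-ALL corner (F,2) for non-CM curves plus the off-H₃ rank-0 classes: even Tamagawa, non-surjective mod-2 image, Δ>0, 2-adic defects — no mechanism of this route reaches it; open by declaration.
    sources: arXiv:2312.09301, WZhang2014, doi:10.5802/jtnb.1091
[crux · declared RESIDUAL of LINE 11 · A5] OffDefiniteHabitatAtTwo off the anchored-twist cell:
non-CM W, r_an ≤ 1, not (r_an = 0 ∧ H₃), and NOT in the cell {r_an(W) = 1 ∧ W ≅ B^{(d_K)} for a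
definite anchor B (non-CM, r_an(B) = 0, H₃, Δ_B<0, odd N_B, surjective 2-adic tower, odd Tamagawa
product), K admissible (odd d_K ≠ −3, Heegner for N_B, non-square conditions) with an optimal
odd-Manin frame and y_K ∈ B(K) of infinite order} ⇒ BSD₂(W). Census (pen, Cremona ≤ 5·10^5, modulo
the 2-adic tower / Frobenius-at-2 / Manin clauses): the cell holds 347 rank-1 curves, ALL with even
Tamagawa product (I₀* fibres at q | d_K) and odd Ш_an ∈ {1, 9} — e.g. 539d (11a^{(−7)},
Gross–Zagier's original pair), 3283e1 (67a1^{(−7)}), 3971b (11a^{(−19)}), 4275k (19a^{(−15)}),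
5341a1 (109a1^{(−7)}); infinite per anchor since every Heegner d_K gives odd analytic rank.
Summit-hard by declaration; listed so the split is honest; the only residual open under 23667 after
this edit. [difficulty: open-problem] -/
@[route_item "route-BirchSwinnertonDyer-DefiniteGrossPeriodAtTwo"]
def OffAnchoredTwistResidualAtTwo : Prop :=
  ∀ (W : WeierstrassCurve ℚ) [W.IsElliptic] [W.IsGloballyMinimal], ¬ W.HasCM → W.analyticRank ≤ 1 → ¬ (W.analyticRank = 0 ∧ (W.HasSurjectiveModNGaloisRep (2 : ℤ) ∧ ¬ IsSquare (-(W.Δ)) ∧ Squarefree (W.conductorNorm ℤ) ∧ (∀ q ∈ (W.conductorNorm ℤ).primeFactors, Odd ((W.minimalDiscriminantNorm ℤ).factorization q)) ∧ (¬ 2 ∣ W.conductorNorm ℤ → ∃ v : IsDedekindDomain.HeightOneSpectrum (NumberField.RingOfIntegers ℚ), ((2 : ℕ) : NumberField.RingOfIntegers ℚ) ∈ v.asIdeal ∧ ∃ 𝔓 ∈ v.primesAbove, ∃ σ ∈ 𝔓.decompositionSubgroup (Field.absoluteGaloisGroup ℚ), ∃ P : W.geomTorsion (2 : ℤ), σ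 • P ≠ P))) → ¬ (W.analyticRank = 1 ∧ ∃ (B : WeierstrassCurve ℚ) (_ : B.IsElliptic) (_ : B.IsGloballyMinimal) (_ : NeZero (B.conductorNorm ℤ)), ¬ B.HasCM ∧ B.analyticRank = 0 ∧ (B.HasSurjectiveModNGaloisRep (2 : ℤ) ∧ ¬ IsSquare (-(B.Δ)) ∧ Squarefree (B.conductorNorm ℤ) ∧ (∀ q ∈ (B.conductorNorm ℤ).primeFactors, Odd ((B.minimalDiscriminantNorm ℤ).factorization q)) ∧ (¬ 2 ∣ B.conductorNorm ℤ → ∃ v : IsDedekindDomain.HeightOneSpectrum (NumberField.RingOfIntegers ℚ), ((2 : ℕ) : NumberField.RingOfIntegers ℚ) ∈ v.asIdeal ∧ ∃ 𝔓 ∈ v.primesAbove, ∃ σ ∈ 𝔓.decompositionSubgroup (Field.absoluteGaloisGroup ℚ), ∃ P : B.geomTorsion (2 : ℤ), σ • P ≠ P)) ∧ B.Δ < 0 ∧ ¬ 2 ∣ B.conductorNorm ℤ ∧ (∀ n : ℕ, 0 < n → B.HasSurjectiveModNGaloisRep ((2 : ℤ) ^ n)) ∧ Odd B.tamagawaProduct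 ∧ ∃ (K : Type) (_ : Field K) (_ : NumberField K), Literature.NumberTheory.EllipticCurves.IsImaginaryQuadratic K ∧ Odd (NumberField.discr K) ∧ NumberField.discr K ≠ -3 ∧ Literature.NumberTheory.EllipticCurves.SatisfiesHeegnerHypothesis (B.conductorNorm ℤ) K ∧ ¬ IsSquare ((NumberField.discr K : ℚ) * -|B.Δ|) ∧ ¬ IsSquare ((NumberField.discr K : ℚ) * (-(2 * |B.Δ|))) ∧ (∃ C : WeierstrassCurve.VariableChange ℚ, C • B.quadraticTwist (NumberField.discr K : ℚ) = W) ∧ ∃ (Dt : Literature.NumberTheory.EllipticCurves.ModularForms.ModularParametrizationData B (B.conductorNorm ℤ)) (β : ℤ) (ι : K →+* ℂ) (d₁ : Literature.NumberTheory.EllipticCurves.KolyvaginHeegnerData Dt β ι 1), (∀ z ∈ Dt.L.lattice, ∃ w ∈ Literature.NumberTheory.EllipticCurves.ModularForms.periodLattice Dt.f, z = (Dt.c : ℂ) * w) ∧ Odd Dt.c ∧ ¬ IsOfFinAddOrder d₁.derivedPoint) → Literature.NumberTheory.EllipticCurves.BSDp W 2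

-- parent: OffDefiniteHabitatAtTwo · child (gen 1)
/--     item stmt-BirchSwinnertonDyer-27577 · support · rank 503 · open
    parent: OffDefiniteHabitatAtTwo · by planner
    sources: GrossZagier1986, Milne1972, Kramer1981, GrossLMS1991
[support · print-grade · A3] MIRROR EXACT DESCENT AT 2: B of analytic rank 0 (non-CM, odd Tamagawa
product, optimal odd-Manin frame), K admissible with odd d_K ≠ −3 (so u_K = 1) and Heegner, y_K of
infinite order with exact exponent M₀, #Ш(B/K)[2^∞] = 2^{2M₀} and BSD₂(B) ⇒ BSD₂(B^{(d_K)}) for the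
globally minimal analytic-rank-1 twist. It is GK2's ExactDescentAtTwo (22138) /
ShiftedExactDescentAtTwo read in the other direction: L(B/K,s) = L(B,s)·L(B^{(d_K)},s); Gross–Zagier
at full 2-adic precision (Manin odd, u_K = 1) and Cassels–Tate isogeny invariance for Res_{K/ℚ} B_K
~ B × B^{(d_K)} (Milne 1972; Kramer 1981 for the local norm indices) make BSD₂(B/K) the SUM of the
two 2-adic valuation identities; one summand known ⇒ the other. Bookkeeping only. [difficulty: M] -/
@[route_item "route-BirchSwinnertonDyer-DefiniteGrossPeriodAtTwo"]
def MirrorExactDescentAtTwo : Prop :=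
  ∀ (W : WeierstrassCurve ℚ) [W.IsElliptic] [W.IsGloballyMinimal] [NeZero (W.conductorNorm ℤ)], ¬ W.HasCM → W.analyticRank = 0 → Odd W.tamagawaProduct → ∀ (K : Type) [Field K] [NumberField K], Literature.NumberTheory.EllipticCurves.IsImaginaryQuadratic K → Odd (NumberField.discr K) → NumberField.discr K ≠ -3 → Literature.NumberTheory.EllipticCurves.SatisfiesHeegnerHypothesis (W.conductorNorm ℤ) K → ∀ (Dt : Literature.NumberTheory.EllipticCurves.ModularForms.ModularParametrizationData W (W.conductorNorm ℤ)), (∀ z ∈ Dt.L.lattice, ∃ w ∈ Literature.NumberTheory.EllipticCurves.ModularForms.periodLattice Dt.f, z = (Dt.c : ℂ) * w) → Odd Dt.c → ∀ (β : ℤ) (ι : K →+* ℂ) (d₁ : Literature.NumberTheory.EllipticCurves.KolyvaginHeegnerData Dt β ι 1), ¬ IsOfFinAddOrder d₁.derivedPoint → ∀ (M₀ : ℕ), (∃ Q : (W.baseChange (Literature.NumberTheory.EllipticCurves.ringClassField K ι 1)).toAffine.Point, ((2 ^ M₀ : ℕ) : ℤ) • Q = d₁.derivedPoint) → ¬ (∃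 Q : (W.baseChange (Literature.NumberTheory.EllipticCurves.ringClassField K ι 1)).toAffine.Point, ((2 ^ (M₀ + 1) : ℕ) : ℤ) • Q = d₁.derivedPoint) → Nat.card (AddCommGroup.primaryComponent (W.baseChange K).sha 2) = 2 ^ (2 * M₀) → Literature.NumberTheory.EllipticCurves.BSDp W 2 → ∀ (Wd : WeierstrassCurve ℚ) [Wd.IsElliptic] [Wd.IsGloballyMinimal], (∃ C : WeierstrassCurve.VariableChange ℚ, C • W.quadraticTwist (NumberField.discr K : ℚ) = Wd) → Wd.analyticRank = 1 → Literature.NumberTheory.EllipticCurves.BSDp Wd 2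

-- parent: OffDefiniteHabitatAtTwo · child (gen 1)
/--     item stmt-BirchSwinnertonDyer-27578 · support · rank 504 · open
    parent: OffDefiniteHabitatAtTwo · by planner
    sources: arXiv:1804.11191, GrossLMS1987, doi:10.1007/s00222-004-0384-7
[support · A4 · THIS ROUTE'S OWN RANK-0 OUTPUT, restated for the glue] BSD₂ for non-CM
analytic-rank-0 curves on the definite habitat H₃ (exactly the habitat clause of
OffDefiniteHabitatAtTwo 23667). Not a new claim: it follows from the GrossPeriodUnit family (23664:
26983–26985) ∧ the DefiniteMultiplicityOne family (23665: 25334, 25356, 24588, 24589, 19266, 24590)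
∧ KatoBoundAtTwo (23666) by the route's `closes` term restricted to H₃; a prover closes it with that
term once those items close. Listed as a child so that the anchored cell's glue is self-contained
and the dependency on the route's own cruxes is explicit. Probe (informational): NonCMAtTwo → A4, A4
↛ NonCMAtTwo. [difficulty: S given 23664–23666] -/
@[route_item "route-BirchSwinnertonDyer-DefiniteGrossPeriodAtTwo"]
def DefiniteAnchorBSDTwo : Prop :=
  ∀ (W : WeierstrassCurve ℚ) [W.IsElliptic] [W.IsGloballyMinimal], ¬ W.HasCM → W.analyticRank = 0 → (W.HasSurjectiveModNGaloisRep (2 : ℤ) ∧ ¬ IsSquare (-(W.Δ)) ∧ Squarefree (W.conductorNorm ℤ) ∧ (∀ q ∈ (W.conductorNorm ℤ).primeFactors, Odd ((W.minimalDiscriminantNorm ℤ).factorization q)) ∧ (¬ 2 ∣ W.conductorNorm ℤ → ∃ v : IsDedekindDomain.HeightOneSpectrum (NumberField.RingOfIntegers ℚ), ((2 : ℕ) : NumberField.RingOfIntegers ℚ) ∈ v.asIdeal ∧ ∃ 𝔓 ∈ v.primesAbove, ∃ σ ∈ 𝔓.decompositionSubgroup (Field.absoluteGaloisGroup ℚ),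 ∃ P : W.geomTorsion (2 : ℤ), σ • P ≠ P)) → Literature.NumberTheory.EllipticCurves.BSDp W 2

-- parent: OffDefiniteHabitatAtTwo · glue (gen 1)
/--     item stmt-BirchSwinnertonDyer-27580 · support · rank 506 · closed · proved by Summit.BirchSwinnertonDyer.BirchSwinnertonDyer.Theses.DefiniteGrossPeriodAtTwo.offDefiniteHabitatAtTwoOfAnchor_proof (planner)
    parent: OffDefiniteHabitatAtTwo · GLUE: children ⟹ parent · by planner
LINE 11 glue (proved in pen scratch line11/Sketch11.lean, rc 0, 0 sorries): AnchorPrimitivityAtTwo →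
KolyvaginExactAtTwoShifted → MirrorExactDescentAtTwo → DefiniteAnchorBSDTwo →
OffAnchoredTwistResidualAtTwo → OffDefiniteHabitatAtTwo — case split on the anchored-twist cell
{r_an(W) = 1 ∧ W ≅ B^(d_K), B a definite anchor (non-CM, r_an 0, H₃, Δ<0, odd N, 2-adic tower, odd
c), K admissible with optimal odd-Manin frame and y_K of infinite order}: on the cell take M₀ and
the depth-1 certificate from AnchorPrimitivityAtTwo, universal 2^s-divisibility for s ≤ t = 0 is
trivial, #Ш(B/K)[2^∞] = 2^(2M₀) from KolyvaginExactAtTwoShifted at t = 0, BSD₂(B) from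
DefiniteAnchorBSDTwo (this route's own rank-0 output on H₃), then MirrorExactDescentAtTwo gives
BSD₂(W); off the cell the residual applies verbatim. -/
@[route_item "route-BirchSwinnertonDyer-DefiniteGrossPeriodAtTwo"]
def OffDefiniteHabitatAtTwoOfAnchor : Prop :=
  AnchorPrimitivityAtTwo → KolyvaginExactAtTwoShifted → MirrorExactDescentAtTwo → DefiniteAnchorBSDTwo → OffAnchoredTwistResidualAtTwo → OffDefiniteHabitatAtTwo

-- `OffDefiniteHabitatAtTwoOfAnchor` holds: proved by `Summit.BirchSwinnertonDyer.BirchSwinnertonDyer.Theses.DefiniteGrossPeriodAtTwo.offDefiniteHabitatAtTwoOfAnchor_proof` (its module imports this route file, so no `_holds` link can be stated here).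

/-- item stmt-BirchSwinnertonDyer-19921 · aside · rank 9 · open · by operator
sources: GrossZagier1986, Kolyvagin1990, Kolyvagin1989
[support] The one PUBLISHED input the halves-glue consumes: Gross–Zagier–Kolyvagin, rank = analytic
rank for analytic rank ≤ 1 with Ш finite (tree named fact
rank_eq_analyticRank_of_analyticRank_le_one; used by bsdp_of_missingPPartAt to turn Miller's last
clause into BSD(E,2)). Carried as a displayed PUB hypothesis; never counted as progress. The further
PRINT of the roads to the two halves (Greenberg Thm-4.1 analogues at a multiplicative prime
thm41Analogue_charValue_rankZero_numberField_anyPrime / …_split_baseChange_anyPrime, modularity) and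
the referee-passed MEMO inputs (Kato ⊗ℚ at a multiplicative 2:
X5.O1.KatoMultiplicativeDivisibilityRat W 2, HOME mult/PROOF-MULT.md RC-2; Greenberg–Stevens at 2:
greenberg_stevens W 2, mult/PROOF-GS2.md RC-4) enter the LINES under the halves (bridge
multiplicativeRankZeroAtTwo_of_muRoad, p409679), not this glue. -/
@[route_item "route-BirchSwinnertonDyer-DefiniteGrossPeriodAtTwo"]
def GZKInputAtTwo : Prop :=
  Literature.NumberTheory.EllipticCurves.rank_eq_analyticRank_of_analyticRank_le_one

/-- item stmt-BirchSwinnertonDyer-23668 · support · rank 9 · open · by planner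
sources: Gross1987, Waldspurger1985, BumpFriedbergHoffstein1990, FriedbergHoffstein1995, arXiv:2306.17784
[support] [S, card P1] Supply of the Gross datum on H₃ in analytic rank 0: there is an imaginary
quadratic K with (d_K, 2N) = 1 and a factorisation N = N⁺N⁻ (N⁻ = product of the primes inert in K,
odd in number, all odd) such that L(E/K, s) does not vanish at s = 1 (BumpFriedbergHoffstein1990 /
FriedbergHoffstein1995 non-vanishing of quadratic twists with prescribed local behaviour; analytic
rank of E/K = r_an(E) + r_an(E^K) = 0), together with `GrossPointData` (Eichler order of level N⁺ in
the definite quaternion algebra of discriminant N⁻, an optimal embedding of O_K — exists since every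
q | N⁺ splits and every q | N⁻ is inert — the Jacquet–Langlands/Brandt eigenvector of f_E) and
ψ_f(P_K) ≠ 0 (Gross–Waldspurger: ψ_f(P_K)² ≐ L(E/K,1) ≠ 0). [difficulty: M] -/
@[route_item "route-BirchSwinnertonDyer-DefiniteGrossPeriodAtTwo", crux]
def DefiniteGrossDataSupply : Prop :=
  ∀ (W : WeierstrassCurve ℚ) [W.IsElliptic] [W.IsGloballyMinimal], ¬ W.HasCM → (W.HasSurjectiveModNGaloisRep (2 : ℤ) ∧ ¬ IsSquare (-(W.Δ)) ∧ Squarefree (W.conductorNorm ℤ) ∧ (∀ q ∈ (W.conductorNorm ℤ).primeFactors, Odd ((W.minimalDiscriminantNorm ℤ).factorization q)) ∧ (¬ 2 ∣ W.conductorNorm ℤ → ∃ v : IsDedekindDomain.HeightOneSpectrum (NumberField.RingOfIntegers ℚ), ((2 : ℕ) : NumberField.RingOfIntegers ℚ) ∈ v.asIdeal ∧ ∃ 𝔓 ∈ v.primesAbove, ∃ σ ∈ 𝔓.decompositionSubgroup (Field.absoluteGaloisGroup ℚ), ∃ P : W.geomTorsion (2 : ℤ), σ • P ≠ P)) → W.analyticRank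 = 0 → ∃ (K : Type) (_ : Field K) (_ : NumberField K) (Nplus Nminus : ℕ) (a b : ℚ) (O : Subring (QuaternionAlgebra ℚ a 0 b)) (ψ : K →ₐ[ℚ] QuaternionAlgebra ℚ a 0 b) (I : Submodule ℤ (QuaternionAlgebra ℚ a 0 b)) (φ : Submodule ℤ (QuaternionAlgebra ℚ a 0 b) → ℤ) (rep : ClassGroup (NumberField.RingOfIntegers K) → nonZeroDivisors (Ideal (NumberField.RingOfIntegers K))) (RI : Set (Submodule ℤ (QuaternionAlgebra ℚ a 0 b))) (IsEig : (Submodule ℤ (QuaternionAlgebra ℚ a 0 b) → ℤ) → Prop), (Module.finrank ℚ K = 2 ∧ NumberField.IsTotallyComplex K ∧ Int.gcd (NumberField.discr K) (W.conductorNorm ℤ * 2) = 1 ∧ W.conductorNorm ℤ = Nplus * Nminus ∧ Nat.Coprime Nplus Nminus ∧ ¬ 2 ∣ Nminus ∧ Odd Nminus.primeFactors.card ∧ (∀ q : ℕ, q.Prime → q ∣ Nplus → ((Ideal.span {(q : ℤ)}).primesOver (NumberField.RingOfIntegers K)).ncard = 2) ∧ (∀ q : ℕ, q.Prime → q ∣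 Nminus → ((Ideal.span {(q : ℤ)}).primesOver (NumberField.RingOfIntegers K)).ncard = 1)) ∧ Literature.NumberTheory.EllipticCurves.BertoliniLongoVenerucci2026.GrossPointData W Nplus Nminus a b O K ψ I φ rep RI IsEig ∧ Literature.NumberTheory.EllipticCurves.BertoliniLongoVenerucci2026.grossPeriod K ψ I φ rep ≠ 0 ∧ (W.baseChange K).analyticRank = 0

/-- item stmt-BirchSwinnertonDyer-23669 · support · rank 9 · open · by planner
sources: doi:10.1007/BF01405166, Kolyvagin1989, arXiv:1010.2431, Kato2004
[support] [D, card P2] Descent K → ℚ at 2: if E/ℚ and E/K have analytic rank 0, #Sel_(2^∞)(E/K) =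
2^m and ord₂ #Ш_an(E/K) = m, and the one-sided bounds ord₂ #Ш[2^∞] ≤ ord₂ #Ш_an hold for E/ℚ and for
(a globally minimal model of) E^(d_K)/ℚ, then BSD_2(E/ℚ). Proof sketch: rank E(K) = 0
(Kolyvagin/Kato from L(E/K,1) ≠ 0, or from finiteness of Sel), so #Ш(E/K)[2^∞] = 2^m = 2-part of
#Ш_an(E/K); Milne 1972 (Weil restriction, tree `Milne1972.WeilRestrictionQuadraticBSDQuotient…`)
gives #Ш_an(E/K) = #Ш_an(E)·#Ш_an(E^K) up to the 2-power-free isogeny bookkeeping already in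
`BSDQuotientOverNumberField`, and Ш(E/K)[2^∞] ⊇-counts Ш(E)[2^∞] ⊕ Ш(E^K)[2^∞] up to the
kernel/cokernel of restriction–corestriction, which is 2-torsion-free-controlled when E(K)[2] = 0
(H₃: ρ̄ surjective); two one-sided inequalities summing to an equality are equalities. [difficulty:
M] -/
@[route_item "route-BirchSwinnertonDyer-DefiniteGrossPeriodAtTwo", crux]
def DefiniteDescentAtTwo : Prop :=
  ∀ (W : WeierstrassCurve ℚ) [W.IsElliptic] [W.IsGloballyMinimal] (K : Type) [Field K] [NumberField K] (Nplus Nminus : ℕ), (Module.finrank ℚ K = 2 ∧ NumberField.IsTotallyComplex K ∧ Int.gcd (NumberField.discr K) (W.conductorNorm ℤ * 2) = 1 ∧ W.conductorNorm ℤ = Nplus * Nminus ∧ Nat.Coprime Nplus Nminus ∧ ¬ 2 ∣ Nminus ∧ Odd Nminus.primeFactors.card ∧ (∀ q : ℕ, q.Prime → q ∣ Nplus → ((Ideal.span {(q : ℤ)}).primesOver (NumberField.RingOfIntegers K)).ncard = 2) ∧ (∀ q : ℕ, q.Prime → q ∣ Nminus → ((Ideal.span {(q : ℤ)}).primesOver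 (NumberField.RingOfIntegers K)).ncard = 1)) → W.analyticRank = 0 → (W.baseChange K).analyticRank = 0 → (∃ m : ℕ, Nat.card ((W.baseChange K).selmerGroupPInfty 2) = 2 ^ m ∧ ∃ q : ℚ, Literature.NumberTheory.EllipticCurves.analyticSha (W.baseChange K) = (q : ℂ) ∧ padicValRat 2 q = m) → (Finite (AddCommGroup.primaryComponent W.sha 2) ∧ ∃ q : ℚ, Literature.NumberTheory.EllipticCurves.shaAn W = (q : ℂ) ∧ ((padicValNat 2 (Nat.card (AddCommGroup.primaryComponent W.sha 2)) : ℤ) ≤ padicValRat 2 q)) → (∀ (Wd : WeierstrassCurve ℚ) [Wd.IsElliptic] [Wd.IsGloballyMinimal], (∃ C : WeierstrassCurve.VariableChange ℚ, C • W.quadraticTwist (NumberField.discr K : ℚ) = Wd) → Wd.analyticRank = 0 → (Finite (AddCommGroup.primaryComponent Wd.sha 2) ∧ ∃ q : ℚ, Literature.NumberTheory.EllipticCurves.shaAn Wd = (q : ℂ) ∧ ((padicValNat 2 (Nat.card (AddCommGroup.primaryComponent Wd.sha 2)) : ℤ) ≤ padicValRat 2 q))) → Literature.NumberTheory.EllipticCurves.BSDp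 W 2

/-- item stmt-BirchSwinnertonDyer-23670 · assembly · rank 1 · closed · proved by Summit.BirchSwinnertonDyer.BirchSwinnertonDyer.Theorems.definiteGrossPeriodAtTwo_assembly_proof (prover) · by planner
sources: arXiv:2306.17784, Gross1987, Kato2004, doi:10.1007/BF01405166
[assembly] GrossPeriodExactnessAtTwo → GrossPeriodAnalyticShaAtTwo → KatoBoundAtTwo →
DefiniteGrossDataSupply → DefiniteDescentAtTwo → OffDefiniteHabitatAtTwo → Rank1Residual.NonCMAtTwo
(the K4 leaf; `closes_target`). -/
@[route_item "route-BirchSwinnertonDyer-DefiniteGrossPeriodAtTwo"]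
def Assembly : Prop :=
  GrossPeriodExactnessAtTwo → GrossPeriodAnalyticShaAtTwo → KatoBoundAtTwo → DefiniteGrossDataSupply → DefiniteDescentAtTwo → OffDefiniteHabitatAtTwo → Summit.BirchSwinnertonDyer.BirchSwinnertonDyer.Rank1Residual.NonCMAtTwo

-- `Assembly` holds: proved by `Summit.BirchSwinnertonDyer.BirchSwinnertonDyer.Theorems.definiteGrossPeriodAtTwo_assembly_proof` (its module imports this route file, so no `_holds` link can be stated here).

/-! D-0027 §2.1 — DECIDING THEOREM (planner-authored via `route open/edit --closes-file`; by planner-bsd-idea-1-g2-0 2026-08-27T23:31:53Z):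
its hypotheses are this route's items and its conclusion the registered leaf `Summit.BirchSwinnertonDyer.BirchSwinnertonDyer.Rank1Residual.NonCMAtTwo` (rung K4, D-0061) (glue_lint), and it elaborates with this file. -/

@[closes "route-BirchSwinnertonDyer-DefiniteGrossPeriodAtTwo"] theorem closes (h₁ : GrossPeriodExactnessAtTwo) (h₂ : GrossPeriodAnalyticShaAtTwo) (h₃ : KatoBoundAtTwo)
    (h₄ : DefiniteGrossDataSupply) (h₅ : DefiniteDescentAtTwo) (h₆ : OffDefiniteHabitatAtTwo) :
    Summit.BirchSwinnertonDyer.BirchSwinnertonDyer.Rank1Residual.NonCMAtTwo := by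
  intro W _ _ hCM hr
  by_cases hH : W.analyticRank = 0 ∧ (W.HasSurjectiveModNGaloisRep (2 : ℤ) ∧ ¬ IsSquare (-(W.Δ)) ∧ Squarefree (W.conductorNorm ℤ) ∧ (∀ q ∈ (W.conductorNorm ℤ).primeFactors, Odd ((W.minimalDiscriminantNorm ℤ).factorization q)) ∧ (¬ 2 ∣ W.conductorNorm ℤ → ∃ v : IsDedekindDomain.HeightOneSpectrum (NumberField.RingOfIntegers ℚ), ((2 : ℕ) : NumberField.RingOfIntegers ℚ) ∈ v.asIdeal ∧ ∃ 𝔓 ∈ v.primesAbove, ∃ σ ∈ 𝔓.decompositionSubgroup (Field.absoluteGaloisGroup ℚ), ∃ P : W.geomTorsion (2 : ℤ), σ • P ≠ P))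
  · obtain ⟨K, iF, iN, Nplus, Nminus, a, b, O, ψ, I, φ, rep, RI, IsEig, hF, hG, hP, hrK⟩ :=
      h₄ W hCM hH.2 hH.1
    have hSel := h₁ W Nplus Nminus a b O K ψ I φ rep RI IsEig hCM hH.2 hF hG hP
    have hAn := h₂ W Nplus Nminus a b O K ψ I φ rep RI IsEig hCM hH.2 hF hG hP
    have hK := h₃ W hCM hH.2 hH.1
    refine h₅ W K Nplus Nminus hF hH.1 hrK ⟨_, hSel, ?_⟩ hK.1 ?_
    · obtain ⟨q, hq, hv⟩ := hAn
      exact ⟨q, hq, by rw [hv]; push_cast; ring⟩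
    · intro Wd _ _ hC hrd
      exact hK.2 (NumberField.discr K) hF.2.2.1 Wd hC hrd
  · exact h₆ W hCM hr hH

end Summit.BirchSwinnertonDyer.BirchSwinnertonDyer.Theses.DefiniteGrossPeriodAtTwo
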